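import Literature.Computability.Complexity.SkelGen
import HarnessLib

/-!
# The clause generator of the skeleton reduction, II: agreement with the skeleton

Literature / circuit complexity (serves `williams_acc` through the leaf
`Williams2014_fact_3_1_skeleton`). For the data `d` of a verifier and a language `L`, the
description `descOf d L` (cap offset, scalars, instruction table, goodness tables) makes the
universal generator compute the skeleton: `ugen (descOf d L, (n, i, b)) = skAll L d n i b`
(`ugen_descOf`). The proof computes the environment built by `prmExprs` (`env_eq`), then
compares the output stage with `SkTable.skTable` (table mode) and with `skTab` (the tableau:
unit clauses, and the compiled clauses of `conN`, family by family: ranges, truth tables,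
addresses).

## References

* L. Fortnow, R. Lipton, D. van Melkebeek, A. Viglas, *Time–space lower bounds for
  satisfiability*, J. ACM 52 (2005), §3.1 [FortnowEtAl2005].
* R. Williams, *Nonuniform ACC circuit lower bounds*, J. ACM 61 (2014), Fact 3.1 [Williams2014].
-/

namespace Literature.Computability.Complexity

namespace Tableau

open StackEvents FlatRun Benes _root_.Computability SkelExpr.NE

namespace SkelGen

set_option maxHeartbeats 800000
-- The 32 family cases of `famOK_of_facts` share one uniform (generated) simp set; not every
-- lemma of the set is used in every case.
set_option linter.unusedSimpArgs false

variable (d : SkData) (Lg : Language Bool)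

/-! ### The description of a verifier -/

/-- The instruction-table row of address `q`: kind (`0` halt, `1` push, `2` pop, `3` goto),
register, pushed symbol, and the targets of the three popped-claim patterns. [folklore] -/
def irow {K : ℕ} (P : AProg Bool (Fin K)) (q : ℕ) : List ℕ :=
  match P[q]? with
  | none => [0, 0, 0, q, q, q]
  | some (.push k a) => [1, k.val, (if a then 1 else 0), q + 1, q + 1, q + 1]
  | some (.pop k j) => [2, k.val, 0, j none, j (some false), j (some true)]
  | some (.goto j) => [3, 0, 0, j, j, j]

/-- The instruction table. [folklore] -/
def itab {K : ℕ} (P : AProg Bool (Fin K)) : List (List ℕ) := (List.range (P.length + 1)).map (irow P)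

open Classical in
/-- The goodness tables of table mode: for `n < N₀`, `z < 2ⁿ ↦ [strOf n z ∈ L]`. [folklore] -/
noncomputable def gtab : List (List ℕ) :=
  (List.range d.N₀).map fun n => (List.range (2 ^ n)).map fun z => if SkTable.Good Lg n z then 1 else 0

/-- The scalars `[K, inp, out, c₀, e, C, N₀, |P|]`. [folklore] -/
def scal : List ℕ := [d.K, d.inp.val, d.out.val, d.c₀, d.e, d.C, d.N₀, d.P.length]

/-- **The description of the verifier** handed to the universal generator. [folklore] -/
noncomputable def descOf : SkelExpr.Env := (d.C + 70, scal d, itab d.P, gtab d Lg)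

/-! ### The environment -/

open Classical in
/-- The numbers of the environment after `prmExprs` (positions `0 … 43`). [folklore] -/
noncomputable def nums (n i : ℕ) (b : Bool) : List ℕ :=
  let K := d.K
  let P2N := 2 ^ n
  let Y := d.c₀ * P2N + d.c₀
  let T := d.e * (d.c₀ * P2N + d.c₀ + (2 * n + 2 + Y) + 1) + d.e
  let I := Y + (2 * n + 2)
  let Send := I + T
  let k := n + d.C
  let S := 2 ^ k
  let L := 2 * k
  let W := 2 * k + 4
  let S2 := 2 * S
  let D := W + d.P.length + 2
  let M := K * (S2 * (D * D))
  let VM := 16 * M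
  let NC := 32 * M
  let NCl := n + 256 * NC
  let im := i - n
  let id := im / 256
  let j := im % 256
  let ρ := j / 4
  let t := j % 4
  let fam := id % 32
  let r1 := id / 32
  let κi := r1 % K
  let r2 := r1 / K
  let si := r2 % S2
  let r3 := r2 / S2
  let ai := r3 % D
  let bi := r3 / D
  let aux := VM + 256 * id + 4 * ρ
  let z := im / (n + 2)
  let u := im % (n + 2)
  let sv0 := n + z * (n + 1)
  let good := ((gtab d Lg).getD n []).getD z 0
  [K, d.inp.val, d.out.val, d.c₀, d.e, d.C, d.N₀, d.P.length, n, i, (if b then 1 else 0),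
    P2N, Y, T, I, Send, k, S, L, W, S2, D, M, VM, NC, NCl, im, id, j, ρ, t, fam, r1, κi, r2, si, r3, ai, bi, aux,
    z, u, sv0, good]

/-- The environment after `prmExprs`. [folklore] -/
noncomputable def envOf (n i : ℕ) (b : Bool) : SkelExpr.Env := (d.C + 70 + n, nums d Lg n i b, itab d.P, gtab d Lg)

/-- **The environment computed by the generator.** [folklore] -/
theorem env_eq (n i : ℕ) (b : Bool) : snocs prmExprs (initEnv (descOf d Lg, (n, i, b))) = envOf d Lg n i b := by
  have hck : min (n + d.C) (d.C + 70 + n) = n + d.C := min_eq_left (by omega)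
  simp [snocs, snoc, initEnv, descOf, scal, prmExprs, envOf, nums, eval, N, K, c, pK, pC0, pE, pC,
    pNP, pN, pI, pP2N, pY, pT, pII, pKK, pS, pW, pS2, pD, pM, pVM, pNC, pIM, pID,
    pJ, pRHO, pR1, pR2, pR3, pZ, List.getD, hck]

/-! ### Reading the environment -/

section Read

variable {d Lg}
variable (n i : ℕ) (b : Bool)

/-- The numbers of `envOf` at the named positions. [folklore] -/
theorem get_envOf (p : ℕ) : (envOf d Lg n i b).2.1.getD p 0 = (nums d Lg n i b).getD p 0 := rfl

/-- Constructor-wise evaluation rules keeping variable look-ups atomic. [folklore] -/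
theorem ev_cst (k : ℕ) (x : SkelExpr.Env) : eval (cst k) x = k := rfl
/-- `ev_c` (auxiliary). [folklore] -/
theorem ev_c (k : ℕ) (x : SkelExpr.Env) : eval (c k) x = k := rfl
/-- `ev_add` (auxiliary). [folklore] -/
theorem ev_add (a b : NE') (x : SkelExpr.Env) : eval (add a b) x = eval a x + eval b x := rfl
/-- `ev_sub` (auxiliary). [folklore] -/
theorem ev_sub (a b : NE') (x : SkelExpr.Env) : eval (sub a b) x = eval a x - eval b x := rfl
/-- `ev_mul` (auxiliary). [folklore] -/
theorem ev_mul (a b : NE') (x : SkelExpr.Env) : eval (mul a b) x = eval a x * eval b x := rfl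
/-- `ev_div` (auxiliary). [folklore] -/
theorem ev_div (a b : NE') (x : SkelExpr.Env) : eval (div a b) x = eval a x / eval b x := rfl
/-- `ev_mod` (auxiliary). [folklore] -/
theorem ev_mod (a b : NE') (x : SkelExpr.Env) : eval (mod a b) x = eval a x % eval b x := rfl
/-- `ev_pow2` (auxiliary). [folklore] -/
theorem ev_pow2 (a : NE') (x : SkelExpr.Env) : eval (pow2 a) x = 2 ^ min (eval a x) x.1 := rfl
/-- `ev_lt` (auxiliary). [folklore] -/
theorem ev_lt (a b : NE') (x : SkelExpr.Env) : eval (lt a b) x = if eval a x < eval b x then 1 else 0 := rfl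
/-- `ev_eq` (auxiliary). [folklore] -/
theorem ev_eq (a b : NE') (x : SkelExpr.Env) : eval (eq a b) x = if eval a x = eval b x then 1 else 0 := rfl
/-- `ev_cond` (auxiliary). [folklore] -/
theorem ev_cond (cc tt e : NE') (x : SkelExpr.Env) :
    eval (cond cc tt e) x = if eval cc x = 0 then eval e x else eval tt x := rfl
/-- `ev_tab1` (auxiliary). [folklore] -/
theorem ev_tab1 (q cc : NE') (x : SkelExpr.Env) : eval (tab1 q cc) x = (x.2.2.1.getD (eval q x) []).getD (eval cc x) 0 := rfl
/-- `ev_tab2` (auxiliary). [folklore] -/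
theorem ev_tab2 (q cc : NE') (x : SkelExpr.Env) : eval (tab2 q cc) x = (x.2.2.2.getD (eval q x) []).getD (eval cc x) 0 := rfl
/-- `ev_not'` (auxiliary). [folklore] -/
theorem ev_not' (a : NE') (x : SkelExpr.Env) : eval (SkelExpr.NE.not' a) x = if eval a x = 0 then 1 else 0 := rfl
/-- `ev_and'` (auxiliary). [folklore] -/
theorem ev_and' (a b : NE') (x : SkelExpr.Env) : eval (SkelExpr.NE.and' a b) x = eval a x * eval b x := rfl
/-- `ev_or'` (auxiliary). [folklore] -/
theorem ev_or' (a b : NE') (x : SkelExpr.Env) : eval (SkelExpr.NE.or' a b) x = if eval a x = 0 then eval b x else 1 := rfl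
/-- `ev_bit` (auxiliary). [folklore] -/
theorem ev_bit (j v : NE') (x : SkelExpr.Env) :
    eval (SkelExpr.NE.bit j v) x = eval v x / 2 ^ min (eval j x) x.1 % 2 := rfl

/-- Dispatch on the family value. [folklore] -/
theorem eval_foldr_cond (f : ℕ → NE') (x : SkelExpr.Env) (dflt : NE') (l : List ℕ) :
    eval (l.foldr (fun fam acc => cond (eq (var pFAM) (c fam)) (f fam) acc) dflt) x =
      if eval (var pFAM) x ∈ l then eval (f (eval (var pFAM) x)) x else eval dflt x := by
  generalize hv : eval (var pFAM) x = v
  induction l with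
  | nil => simp
  | cons a l ih =>
    rw [List.foldr_cons, ev_cond, ev_eq, hv, ev_c, ih]
    by_cases h : v = a
    · subst h; simp
    · rw [if_neg h, if_pos rfl]; simp [h]

/-- Value of a dispatched expression. [folklore] -/
theorem eval_dispatch (f : ℕ → NE') (x : SkelExpr.Env) :
    eval (dispatch f) x = if eval (var pFAM) x < 24 then eval (f (eval (var pFAM) x)) x else eval (f 24) x := by
  unfold dispatch
  rw [eval_foldr_cond]
  simp only [List.mem_range]

end Read

/-! ### Table mode -/

section Table

variable {d Lg}

/-- A literal of two expressions, evaluated. [folklore] -/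
theorem litOf_eq (a p : NE') (x : SkelExpr.Env) : litOf a p x = (eval a x, !decide (eval p x = 0)) := rfl

/-- In table mode the generator outputs `SkTable.skTable`. [folklore] -/
theorem tabOut_eq {n : ℕ} (hn : n < d.N₀) (i : ℕ) (b : Bool) :
    tabOut (envOf d Lg n i b) = SkTable.skTable Lg n i b := by
  classical
  set x := envOf d Lg n i b with hx
  set z := (i - n) / (n + 2) with hz
  set u := (i - n) % (n + 2) with hu
  have hcap : x.1 = d.C + 70 + n := rfl
  have eN : eval N x = n := by simp [hx, envOf, nums, pN, N, eval]
  have eI : eval (var pI) x = i := by simp [hx, envOf, nums, pI, eval]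
  have eB : eval (var pB) x = (if b then 1 else 0) := by simp [hx, envOf, nums, pB, eval]
  have eP2N : eval (var pP2N) x = 2 ^ n := by simp [hx, envOf, nums, pP2N, eval]
  have eZ : eval (var pZ) x = z := by simp [hx, envOf, nums, pZ, eval, hz]
  have eU : eval (var pU) x = u := by simp [hx, envOf, nums, pU, eval, hu]
  have eSV0 : eval (var pSV0) x = n + z * (n + 1) := by simp [hx, envOf, nums, pSV0, eval, hz]
  have eGOOD : eval (var pGOOD) x = ((gtab d Lg).getD n []).getD z 0 := by simp [hx, envOf, nums, pGOOD, eval, hz]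
  have hgood : ∀ {z}, z < 2 ^ n → ((gtab d Lg).getD n []).getD z 0 = (if SkTable.Good Lg n z then 1 else 0) := by
    intro z hz
    have e1 : (gtab d Lg).getD n [] = (List.range (2 ^ n)).map fun z => if SkTable.Good Lg n z then 1 else 0 := by
      unfold gtab
      rw [List.getD_eq_getElem _ _ (by simpa using hn)]
      simp only [List.getElem_map, List.getElem_range]
    rw [e1, List.getD_eq_getElem _ _ (by simpa using hz)]
    simp only [List.getElem_map, List.getElem_range]
  have hmin : min (u - 1) x.1 = u - 1 := by rw [hcap]; have := Nat.mod_lt (i - n) (show 0 < n + 2 by omega); omega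
  unfold tabOut SkTable.skTable tabLadder SkTable.ladder SkTable.sv
  simp only [ev_lt, SkelExpr.NE.eval_le, ev_eq, ev_add, ev_sub, ev_c, ev_not', ev_bit, litOf_eq,
    eI, eN, eB, eP2N, eZ, eU, eSV0, eGOOD, hmin]
  rw [← hz, ← hu]
  by_cases h1 : i < n
  · simp only [h1, if_true, Nat.one_ne_zero, if_false]; cases b <;> simp
  simp only [h1, if_false, if_true]
  by_cases h2 : z < 2 ^ n
  swap
  · simp [h2]
  rw [hgood h2]
  simp only [h2, if_true, Nat.one_ne_zero, if_false]
  by_cases h3 : SkTable.Good Lg n z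
  · simp [h3]
  simp only [h3, if_false, if_true]
  by_cases h4 : u = 0
  · simp [h4]
  simp only [h4, if_false]
  by_cases h5 : u ≤ n
  · simp only [h5, if_true, Nat.one_ne_zero, if_false, ThreeCNF.bit]
    rcases Nat.mod_two_eq_zero_or_one (z / 2 ^ (u - 1)) with h | h <;> simp [h]
  · simp only [h5, if_false, if_true]
    by_cases h6 : u = n + 1
    · simp [h6]
    · simp [h6]

end Table

/-! ### Generic mode: the environment of a query -/

section Generic

variable {d Lg}
variable (n i : ℕ) (b : Bool)

/-- The tableau of length `n`. [folklore] -/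
noncomputable abbrev tbn (d : SkData) (n : ℕ) : TabParams := d.tb n

/-- The facts about the environment used in generic mode. [folklore] -/
structure EnvFacts (d : SkData) (x : SkelExpr.Env) (tb : TabParams) (n i : ℕ) (b : Bool) : Prop where
  cap : x.1 = tb.k + 70
  eK : eval (var pK) x = tb.K
  eINP : eval (var pINP) x = tb.inp.val
  eOUT : eval (var pOUT) x = tb.out.val
  eNP : eval (var pNP) x = tb.np
  eN : eval (var pN) x = n
  eI : eval (var pI) x = i
  eB : eval (var pB) x = (if b then 1 else 0)
  eY : eval (var pY) x = tb.Y
  eII : eval (var pII) x = tb.I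
  eSEND : eval (var pSEND) x = tb.Send
  eKK : eval (var pKK) x = tb.k
  eS : eval (var pS) x = tb.S
  eL : eval (var pL) x = tb.L
  eW : eval (var pW) x = tb.W
  eS2 : eval (var pS2) x = tb.S2
  eD : eval (var pD) x = tb.D
  eVM : eval (var pVM) x = tb.VMAIN
  eNCL : eval (var pNCL) x = tb.NCl
  eID : eval (var pID) x = (i - n) / 256
  eRHO : eval (var pRHO) x = (i - n) % 256 / 4
  eT4 : eval (var pT4) x = (i - n) % 256 % 4
  eFAM : eval (var pFAM) x = (tupOf tb ((i - n) / 256)).1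
  eKI : eval (var pKI) x = (tupOf tb ((i - n) / 256)).2.1
  eSI : eval (var pSI) x = (tupOf tb ((i - n) / 256)).2.2.1
  eAI : eval (var pAI) x = (tupOf tb ((i - n) / 256)).2.2.2.1
  eBI : eval (var pBI) x = (tupOf tb ((i - n) / 256)).2.2.2.2
  eAUX : eval (var pAUX) x = tb.VMAIN + 256 * ((i - n) / 256) + 4 * ((i - n) % 256 / 4)
  itab : x.2.2.1 = itab tb.P
  hn : tb.n = n

/-- The environment of the generator satisfies the facts. [folklore] -/
theorem envFacts : EnvFacts d (envOf d Lg n i b) (d.tb n) n i b where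
  cap := by show d.C + 70 + n = (n + d.C) + 70; omega
  eK := by simp [envOf, nums, K, pK, eval]; rfl
  eINP := by simp [envOf, nums, INP, pINP, eval]; rfl
  eOUT := by simp [envOf, nums, OUT, pOUT, eval]; rfl
  eNP := by simp [envOf, nums, NP, pNP, eval]; rfl
  eN := by simp [envOf, nums, N, pN, eval]
  eI := by simp [envOf, nums, pI, eval]
  eB := by simp [envOf, nums, pB, eval]
  eY := by simp [envOf, nums, Y, pY, eval]; rfl
  eII := by simp [envOf, nums, II, pII, eval]; rfl
  eSEND := by simp [envOf, nums, SEND, pSEND, eval]; rfl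
  eKK := by simp [envOf, nums, KK, pKK, eval]; rfl
  eS := by simp [envOf, nums, S, pS, eval]; rfl
  eL := by simp [envOf, nums, L, pL, eval]; rfl
  eW := by simp [envOf, nums, pW, eval]; rfl
  eS2 := by simp [envOf, nums, S2, pS2, eval]; rfl
  eD := by simp [envOf, nums, D, pD, eval]; rfl
  eVM := by simp [envOf, nums, pVM, eval]; rfl
  eNCL := by simp [envOf, nums, pNCL, eval]; rfl
  eID := by simp [envOf, nums, pID, eval]
  eRHO := by simp [envOf, nums, pRHO, eval]
  eT4 := by simp [envOf, nums, pT4, eval]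
  eFAM := by simp [envOf, nums, pFAM, eval, tupOf]
  eKI := by simp [envOf, nums, KI, pKI, eval, tupOf]; rfl
  eSI := by simp [envOf, nums, SI, pSI, eval, tupOf]; rfl
  eAI := by simp [envOf, nums, AI, pAI, eval, tupOf]; rfl
  eBI := by simp [envOf, nums, BI, pBI, eval, tupOf]; rfl
  eAUX := by simp [envOf, nums, pAUX, eval]; rfl
  itab := rfl
  hn := rfl

end Generic

/-! ### Generic mode: the families -/

section Families

variable {d Lg}

/-- Evaluation of an address expression. [folklore] -/
theorem ev_enc (tg : ℕ) (dκ ds da db : NE') (x : SkelExpr.Env) : eval (enc tg dκ ds da db) x =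
    tg + 16 * (eval dκ x + eval K x * (eval ds x + eval S2 x * (eval da x + eval D x * eval db x))) := rfl
/-- `rvE`. [folklore] -/
theorem ev_rvE (κ ℓ pp w : NE') (x : SkelExpr.Env) : eval (rvE κ ℓ pp w) x = eval (enc 6 κ pp ℓ w) x := rfl
/-- `dum`. [folklore] -/
theorem ev_dum (x : SkelExpr.Env) : eval dum x = eval (enc 11 (c 0) (c 0) (c 0) (c 0)) x := rfl

/-- The numeric address of the variables (unfolded). [folklore] -/
theorem addr_r (tb : TabParams) (κ : Fin tb.K) (ℓ pp w : ℕ) :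
    addr tb (.r κ ℓ pp w) = 6 + 16 * (κ.val + tb.K * (pp + tb.S2 * (ℓ + tb.D * w))) := rfl
/-- `addr_x` (auxiliary). [folklore] -/
theorem addr_x (tb : TabParams) (j : ℕ) : addr tb (.x j) = 0 + 16 * (0 + tb.K * (j + tb.S2 * (0 + tb.D * 0))) := rfl
/-- `addr_yp` (auxiliary). [folklore] -/
theorem addr_yp (tb : TabParams) (j : ℕ) : addr tb (.yp j) = 1 + 16 * (0 + tb.K * (j + tb.S2 * (0 + tb.D * 0))) := rfl
/-- `addr_yv` (auxiliary). [folklore] -/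
theorem addr_yv (tb : TabParams) (j : ℕ) : addr tb (.yv j) = 2 + 16 * (0 + tb.K * (j + tb.S2 * (0 + tb.D * 0))) := rfl
/-- `addr_u` (auxiliary). [folklore] -/
theorem addr_u (tb : TabParams) (s q : ℕ) : addr tb (.u s q) = 3 + 16 * (0 + tb.K * (s + tb.S2 * (q + tb.D * 0))) := rfl
/-- `addr_h` (auxiliary). [folklore] -/
theorem addr_h (tb : TabParams) (κ : Fin tb.K) (s j : ℕ) :
    addr tb (.h κ s j) = 4 + 16 * (κ.val + tb.K * (s + tb.S2 * (j + tb.D * 0))) := rfl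
/-- `addr_hc` (auxiliary). [folklore] -/
theorem addr_hc (tb : TabParams) (κ : Fin tb.K) (s j : ℕ) :
    addr tb (.hc κ s j) = 5 + 16 * (κ.val + tb.K * (s + tb.S2 * (j + tb.D * 0))) := rfl
/-- `addr_sw` (auxiliary). [folklore] -/
theorem addr_sw (tb : TabParams) (κ : Fin tb.K) (ℓ q : ℕ) :
    addr tb (.sw κ ℓ q) = 7 + 16 * (κ.val + tb.K * (q + tb.S2 * (ℓ + tb.D * 0))) := rfl
/-- `addr_lt` (auxiliary). [folklore] -/
theorem addr_lt (tb : TabParams) (κ : Fin tb.K) (pp ii : ℕ) :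
    addr tb (.lt κ pp ii) = 8 + 16 * (κ.val + tb.K * (pp + tb.S2 * (ii + tb.D * 0))) := rfl
/-- `addr_ae` (auxiliary). [folklore] -/
theorem addr_ae (tb : TabParams) (κ : Fin tb.K) (pp j : ℕ) :
    addr tb (.ae κ pp j) = 9 + 16 * (κ.val + tb.K * (pp + tb.S2 * (j + tb.D * 0))) := rfl
/-- `addr_dummy` (auxiliary). [folklore] -/
theorem addr_dummy (tb : TabParams) : addr tb (.dummy : TabVar tb.K) = 11 + 16 * (0 + tb.K * (0 + tb.S2 * (0 + tb.D * 0))) := rfl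

/-- The statement proved family by family: the truth table read by the generator is the truth
table of the constraint, and where it is false the six addresses are the addresses of its
variables. [folklore] -/
def FamOK (x : SkelExpr.Env) (tb : TabParams) (fam κi si ai bi : ℕ) : Prop :=
  (∀ ρ < 64, ThreeCNF.bit ρ (eval (cond (rangeE fam) (ttF fam) (c ttTrue)) x) =
    (conOf tb fam κi si ai bi).pred (ThreeCNF.bit 0 ρ) (ThreeCNF.bit 1 ρ) (ThreeCNF.bit 2 ρ) (ThreeCNF.bit 3 ρ)
      (ThreeCNF.bit 4 ρ) (ThreeCNF.bit 5 ρ)) ∧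
  (∀ ρ < 64, (conOf tb fam κi si ai bi).pred (ThreeCNF.bit 0 ρ) (ThreeCNF.bit 1 ρ) (ThreeCNF.bit 2 ρ) (ThreeCNF.bit 3 ρ)
      (ThreeCNF.bit 4 ρ) (ThreeCNF.bit 5 ρ) = false →
    ∀ m : Fin 6, eval ((addrF fam).getD m.val dum) x = addr tb ((conOf tb fam κi si ai bi).varOf m))

/-- Introduction of `FamOK` from a range test, the in-range constraint and the out-of-range
triviality. [folklore] -/
theorem famOK_intro {x : SkelExpr.Env} {tb : TabParams} {fam κi si ai bi : ℕ} (R : Prop) [Decidable R]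
    (hR : (eval (rangeE fam) x ≠ 0) ↔ R)
    (hin : R → (∃ (P : Bool → Bool → Bool → Bool → Bool → Bool → Bool) (v : List (TabVar tb.K)),
      conOf tb fam κi si ai bi = ⟨v.getD 0 .dummy, v.getD 1 .dummy, v.getD 2 .dummy, v.getD 3 .dummy, v.getD 4 .dummy,
        v.getD 5 .dummy, P⟩ ∧ eval (ttF fam) x = ttOf P ∧ ∀ m < 6, eval ((addrF fam).getD m dum) x = addr tb (v.getD m .dummy)) ∨
      (conOf tb fam κi si ai bi = ACon.triv tb.K ∧ eval (ttF fam) x = ttTrue))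
    (hout : ¬ R → conOf tb fam κi si ai bi = ACon.triv tb.K) : FamOK x tb fam κi si ai bi := by
  have htriv : conOf tb fam κi si ai bi = ACon.triv tb.K → eval (cond (rangeE fam) (ttF fam) (c ttTrue)) x = ttTrue →
      FamOK x tb fam κi si ai bi := fun hc he => by
    rw [FamOK, hc]
    refine ⟨fun ρ hρ => ?_, fun ρ hρ hf => ?_⟩
    · rw [he, ttTrue, bit_ttOf _ hρ]; rfl
    · exact absurd hf (by simp [ACon.triv])
  by_cases h : R
  · have hr : eval (rangeE fam) x ≠ 0 := hR.2 h
    rcases hin h with ⟨P, v, hc, htt, haddr⟩ | ⟨hc, he⟩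
    · refine ⟨fun ρ hρ => ?_, fun ρ hρ _ m => ?_⟩
      · rw [ev_cond, if_neg hr, htt, bit_ttOf _ hρ, hc]
      · rw [haddr m.val m.2, hc]
        fin_cases m <;> rfl
    · exact htriv hc (by rw [ev_cond, if_neg hr, he])
  · have hr : eval (rangeE fam) x = 0 := by by_contra hne; exact h (hR.1 hne)
    exact htriv (hout h) (by rw [ev_cond, if_pos hr, ev_c])

/-- A `0/1` test is nonzero iff its condition holds. [folklore] -/
theorem ite01_ne_zero (P : Prop) [Decidable P] : ((if P then 1 else 0 : ℕ) ≠ 0) ↔ P := by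
  by_cases h : P <;> simp [h]
/-- `ite01_eq_zero` (auxiliary). [folklore] -/
theorem ite01_eq_zero (P : Prop) [Decidable P] : ((if P then 1 else 0 : ℕ) = 0) ↔ ¬ P := by
  by_cases h : P <;> simp [h]
/-- `ite01_mul` (auxiliary). [folklore] -/
theorem ite01_mul (P Q : Prop) [Decidable P] [Decidable Q] :
    ((if P then 1 else 0 : ℕ) * (if Q then 1 else 0)) = (if P ∧ Q then 1 else 0) := by
  by_cases h : P <;> by_cases h' : Q <;> simp [h, h']
/-- `ite01_or` (auxiliary). [folklore] -/
theorem ite01_or (P Q : Prop) [Decidable P] [Decidable Q] :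
    (if (if P then 1 else 0 : ℕ) = 0 then (if Q then 1 else 0 : ℕ) else 1) = (if P ∨ Q then 1 else 0) := by
  by_cases h : P <;> by_cases h' : Q <;> simp [h, h']
/-- `ite01_not` (auxiliary). [folklore] -/
theorem ite01_not (P : Prop) [Decidable P] :
    (if (if P then 1 else 0 : ℕ) = 0 then (1 : ℕ) else 0) = (if ¬ P then 1 else 0) := by
  by_cases h : P <;> simp [h]

/-- The instruction table rows. [folklore] -/
theorem itab_getD {K : ℕ} {P : AProg Bool (Fin K)} {q : ℕ} (hq : q ≤ P.length) : (itab P).getD q [] = irow P q := by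
  unfold itab
  rw [List.getD_eq_getElem _ _ (by simpa using Nat.lt_succ_of_le hq)]
  simp

end Families

/-! ### Generic mode: all families -/

section AllFamilies

variable {d Lg}

/-- Selecting a branch of `cond`. [folklore] -/
theorem sel_pos {x : SkelExpr.Env} {cc t e : NE'} (h : eval cc x ≠ 0) : eval (cond cc t e) x = eval t x := by
  rw [ev_cond, if_neg h]
/-- `sel_zero` (auxiliary). [folklore] -/
theorem sel_zero {x : SkelExpr.Env} {cc t e : NE'} (h : eval cc x = 0) : eval (cond cc t e) x = eval e x := by
  rw [ev_cond, if_pos h]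

/-- Truth tables of pointwise equal predicates agree. [folklore] -/
theorem ttOf_congr {P Q : Bool → Bool → Bool → Bool → Bool → Bool → Bool} (h : ∀ a b c d e f, P a b c d e f = Q a b c d e f) :
    ttOf P = ttOf Q := by
  rw [show P = Q from funext fun a => funext fun b => funext fun c => funext fun d => funext fun e => funext fun f =>
    h a b c d e f]

/-- The dimensions of the Beneš network by position. [folklore] -/
theorem getD_dims : ∀ (k ℓ : ℕ), ℓ < 2 * k → (dims k).getD ℓ 0 = if ℓ < k then ℓ else 2 * k - 1 - ℓ
  | 0, ℓ, h => by omega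
  | k + 1, ℓ, h => by
    rw [dims]
    rcases Nat.eq_zero_or_pos ℓ with rfl | hℓ
    · simp
    obtain ⟨ℓ', rfl⟩ : ∃ ℓ', ℓ = ℓ' + 1 := ⟨ℓ - 1, by omega⟩
    rw [List.getD_cons_succ]
    by_cases h2 : ℓ' < 2 * k
    · rw [List.getD_append _ _ _ _ (by simpa using h2), List.getD_eq_getElem _ _ (by simpa using h2), List.getElem_map,
        ← List.getD_eq_getElem _ 0 (by simpa using h2), getD_dims k ℓ' h2]
      split_ifs <;> omega
    · have h3 : ℓ' = 2 * k := by omega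
      subst h3
      rw [List.getD_append_right _ _ _ _ (by simp)]
      simp only [List.length_map, length_dims, Nat.sub_self, List.getD_cons_zero]
      split_ifs <;> omega

/-- **All families are read correctly by the generator.** [folklore] -/
theorem famOK_of_facts {x : SkelExpr.Env} {tb : TabParams} {n i : ℕ} {b : Bool} (F : EnvFacts d x tb n i b)
    {κi si ai bi : ℕ} (hκ : κi < tb.K) (hs : si < tb.S2) (ha : ai < tb.D) (hb : bi < tb.D)
    (eKI' : eval KI x = κi) (eSI' : eval SI x = si) (eAI' : eval AI x = ai) (eBI' : eval BI x = bi) :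
    ∀ fam < 32, FamOK x tb fam κi si ai bi := by
  intro fam hf
  have eKI : eval (var pKI) x = κi := eKI'
  have eSI : eval (var pSI) x = si := eSI'
  have eAI : eval (var pAI) x = ai := eAI'
  have eBI : eval (var pBI) x = bi := eBI'
  have F.eNP'' : eval NP x = tb.np := F.eNP
  have hcore : conOf tb fam κi si ai bi = conCore tb fam ⟨κi, hκ⟩ si ai bi := conOf_fin ⟨κi, hκ⟩ hf hs ha hb
  -- the machine-phase truth table (family 3)
  have httM : tb.I ≤ si ∧ si < tb.Send ∧ ai ≤ tb.np →
      eval (ttF 3) x = ttOf (fun u t1 t0 sy _ _ => decide (u = true → mspecB tb ⟨κi, hκ⟩ ai t1 t0 sy)) := by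
    rintro ⟨-, -, hq⟩
    have hrow : x.2.2.1.getD ai [] = irow tb.P ai := by rw [F.itab]; exact itab_getD hq
    have ek : eval kindE x = (irow tb.P ai).getD 0 0 := by rw [kindE, ev_tab1, eAI', ev_c, hrow]
    have er : eval regE x = (irow tb.P ai).getD 1 0 := by rw [regE, ev_tab1, eAI', ev_c, hrow]
    have es : eval symE x = (irow tb.P ai).getD 2 0 := by rw [symE, ev_tab1, eAI', ev_c, hrow]
    unfold irow at ek er es
    simp only [ttF]
    rcases hPq : tb.P[ai]? with _ | ⟨k', a⟩ | ⟨k', j⟩ | ⟨j⟩ <;> simp only [hPq, List.getD_cons_zero, List.getD_cons_succ, List.getD_nil] at ek er es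
    · rw [sel_zero (by rw [ev_eq, ek, ev_c]; decide), sel_zero (by rw [ev_eq, ek, ev_c]; decide), ev_c]
      unfold ttMnop; apply ttOf_congr; intros; simp [mspecB, hPq]
    · rw [sel_pos (by rw [ev_eq, ek, ev_c]; decide)]
      by_cases hk : k' = ⟨κi, hκ⟩
      · rw [sel_pos (by rw [ev_eq, er, eKI', hk]; simp)]
        cases a
        · rw [sel_zero (by rw [ev_eq, es, ev_c]; simp), ev_c]; unfold ttMpush; apply ttOf_congr; intros; simp [mspecB, hPq, hk]
        · rw [sel_pos (by rw [ev_eq, es, ev_c]; simp), ev_c]; unfold ttMpush; apply ttOf_congr; intros; simp [mspecB, hPq, hk]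
      · have hne : k'.val ≠ κi := fun hh => hk (Fin.ext hh)
        rw [sel_zero (by rw [ev_eq, er, eKI']; simp [hne]), ev_c]; unfold ttMnop; apply ttOf_congr; intros; simp [mspecB, hPq, hk]
    · rw [sel_zero (by rw [ev_eq, ek, ev_c]; decide), sel_pos (by rw [ev_eq, ek, ev_c]; decide)]
      by_cases hk : k' = ⟨κi, hκ⟩
      · rw [sel_pos (by rw [ev_eq, er, eKI', hk]; simp), ev_c]; unfold ttMpop; apply ttOf_congr; intros; simp [mspecB, hPq, hk]
      · have hne : k'.val ≠ κi := fun hh => hk (Fin.ext hh)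
        rw [sel_zero (by rw [ev_eq, er, eKI']; simp [hne]), ev_c]; unfold ttMnop; apply ttOf_congr; intros; simp [mspecB, hPq, hk]
    · rw [sel_zero (by rw [ev_eq, ek, ev_c]; decide), sel_zero (by rw [ev_eq, ek, ev_c]; decide), ev_c]
      unfold ttMnop; apply ttOf_congr; intros; simp [mspecB, hPq]
  interval_cases fam
  · -- family 0: famRecV1
    refine famOK_intro (R := si < tb.Y) ?_ ?_ ?_
    · simp only [rangeE, ev_rvE, ev_dum, ev_enc, ev_add, ev_sub, ev_mul, ev_div, ev_mod, ev_c, ev_cst, ev_cond, ev_eq, ev_lt, SkelExpr.NE.eval_le, ev_pow2, ev_tab1, ev_and', ev_or', ev_not', ev_bit, eKI, eSI, eAI, eBI, F.eK, F.eKK, F.eS, F.eL, F.eY, F.eII, F.eSEND, F.eNP, F.eINP, F.eOUT, F.eW, F.eS2, F.eD, F.cap, fT1, fT0, fSym, fLev, TabParams.fTim, K, N, KI, SI, AI, BI, KK, S, L, S2, D, Y, II, SEND, NP, INP, OUT, F.eN, ite01_mul, ite01_or, ite01_not]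
      rw [ite01_ne_zero]
    · intro h
      refine Or.inl ⟨_, [TabVar.r tb.inp 0 si fT1, TabVar.r tb.inp 0 si fT0, TabVar.yp (tb.Y - 1 - si), TabVar.r tb.inp 0 si fSym, TabVar.yv (tb.Y - 1 - si)], by rw [hcore]; simp only [conCore]; unfold famRecV1; rw [if_pos h]; rfl, ?_, ?_⟩
      · simp only [ttF, ev_c]; rfl
      · intro m hm
        interval_cases m <;> simp only [addrF, List.getD_cons_zero, List.getD_cons_succ, List.getD_nil, ev_rvE, ev_dum, ev_enc, ev_add, ev_sub, ev_mul, ev_div, ev_mod, ev_c, ev_cst, ev_cond, ev_eq, ev_lt, SkelExpr.NE.eval_le, ev_pow2, ev_tab1, ev_and', ev_or', ev_not', ev_bit, eKI, eSI, eAI, eBI, F.eK, F.eKK, F.eS, F.eL, F.eY, F.eII, F.eSEND, F.eNP, F.eINP, F.eOUT, F.eW, F.eS2, F.eD, F.cap, fT1, fT0, fSym, fLev, TabParams.fTim, K, N, KI, SI, AI, BI, KK, S, L, S2, D, Y, II, SEND, NP, INP, OUT, F.eN, addr_r, addr_x, addr_yp, addr_yv, addr_u, addr_h, addr_hc, addr_sw,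 addr_lt, addr_ae, addr_dummy]
    · intro h; rw [hcore]; simp only [conCore]; unfold famRecV1; rw [if_neg h]
  · -- family 1: famRecV2
    refine famOK_intro (R := si < 2 * tb.n + 2) ?_ ?_ ?_
    · simp only [rangeE, ev_rvE, ev_dum, ev_enc, ev_add, ev_sub, ev_mul, ev_div, ev_mod, ev_c, ev_cst, ev_cond, ev_eq, ev_lt, SkelExpr.NE.eval_le, ev_pow2, ev_tab1, ev_and', ev_or', ev_not', ev_bit, eKI, eSI, eAI, eBI, F.eK, F.eKK, F.eS, F.eL, F.eY, F.eII, F.eSEND, F.eNP, F.eINP, F.eOUT, F.eW, F.eS2, F.eD, F.cap, fT1, fT0, fSym, fLev, TabParams.fTim, K, N, KI, SI, AI, BI, KK, S, L, S2, D, Y, II, SEND, NP, INP, OUT, F.eN, ite01_mul, ite01_or, ite01_not]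
      rw [ite01_ne_zero, F.hn]
    · intro h
      rcases (show si = 0 ∨ si = 1 ∨ 2 ≤ si by omega) with h0 | h1 | h2
      · have hs2 : eval (lt SI (c 2)) x ≠ 0 := by rw [ev_lt, eSI', ev_c, h0]; decide
        refine Or.inl ⟨_, [TabVar.r tb.inp 0 (tb.Y + si) fT1, TabVar.r tb.inp 0 (tb.Y + si) fT0,
          TabVar.r tb.inp 0 (tb.Y + si) fSym],
          by rw [hcore]; simp only [conCore]; unfold famRecV2; rw [if_pos h]; simp only [v2src, h0]; rfl, ?_, ?_⟩
        · simp only [ttF]; rw [sel_pos (by rw [ev_eq, eSI', ev_c, h0]; decide), ev_c]; rfl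
        · intro m hm
          interval_cases m <;> (simp only [addrF, List.getD_cons_zero, List.getD_cons_succ, List.getD_nil]; (try rw [sel_pos hs2]); simp only [ev_rvE, ev_dum, ev_enc, ev_add, ev_sub, ev_mul, ev_div, ev_mod, ev_c, ev_cst, ev_cond, ev_eq, ev_lt, SkelExpr.NE.eval_le, ev_pow2, ev_tab1, ev_and', ev_or', ev_not', ev_bit, eKI, eSI, eAI, eBI, F.eK, F.eKK, F.eS, F.eL, F.eY, F.eII, F.eSEND, F.eNP, F.eINP, F.eOUT, F.eW, F.eS2, F.eD, F.cap, fT1, fT0, fSym, fLev, TabParams.fTim, K, N, KI, SI, AI, BI, KK, S, L, S2, D, Y, II, SEND, NP, INP, OUT, F.eN, addr_r, addr_x, addr_yp, addr_yv, addr_u, addr_h, addr_hc, addr_sw, addr_lt, addr_ae, addr_dummy, F.hn])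
      · have hs2 : eval (lt SI (c 2)) x ≠ 0 := by rw [ev_lt, eSI', ev_c, h1]; decide
        refine Or.inl ⟨_, [TabVar.r tb.inp 0 (tb.Y + si) fT1, TabVar.r tb.inp 0 (tb.Y + si) fT0,
          TabVar.r tb.inp 0 (tb.Y + si) fSym],
          by rw [hcore]; simp only [conCore]; unfold famRecV2; rw [if_pos h]; simp only [v2src, h1]; rfl, ?_, ?_⟩
        · simp only [ttF]
          rw [sel_zero (by rw [ev_eq, eSI', ev_c, h1]; decide), sel_pos (by rw [ev_eq, eSI', ev_c, h1]; decide), ev_c]; rfl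
        · intro m hm
          interval_cases m <;> (simp only [addrF, List.getD_cons_zero, List.getD_cons_succ, List.getD_nil]; (try rw [sel_pos hs2]); simp only [ev_rvE, ev_dum, ev_enc, ev_add, ev_sub, ev_mul, ev_div, ev_mod, ev_c, ev_cst, ev_cond, ev_eq, ev_lt, SkelExpr.NE.eval_le, ev_pow2, ev_tab1, ev_and', ev_or', ev_not', ev_bit, eKI, eSI, eAI, eBI, F.eK, F.eKK, F.eS, F.eL, F.eY, F.eII, F.eSEND, F.eNP, F.eINP, F.eOUT, F.eW, F.eS2, F.eD, F.cap, fT1, fT0, fSym, fLev, TabParams.fTim, K, N, KI, SI, AI, BI, KK, S, L, S2, D, Y, II, SEND, NP, INP, OUT, F.eN, addr_r, addr_x, addr_yp, addr_yv, addr_u, addr_h, addr_hc, addr_sw, addr_lt, addr_ae, addr_dummy, F.hn])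
      · have hs2 : eval (lt SI (c 2)) x = 0 := by rw [ev_lt, eSI', ev_c]; simp; omega
        refine Or.inl ⟨_, [TabVar.r tb.inp 0 (tb.Y + si) fT1, TabVar.r tb.inp 0 (tb.Y + si) fT0,
          TabVar.r tb.inp 0 (tb.Y + si) fSym, TabVar.x (tb.n - 1 - (si - 2) / 2)],
          by rw [hcore]; simp only [conCore]; unfold famRecV2; rw [if_pos h]
             simp only [v2src, show si ≠ 0 by omega, show si ≠ 1 by omega, if_false]; rfl, ?_, ?_⟩
        · simp only [ttF]
          rw [sel_zero (by rw [ev_eq, eSI', ev_c]; simp; omega), sel_zero (by rw [ev_eq, eSI', ev_c]; simp; omega), ev_c]; rfl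
        · intro m hm
          interval_cases m <;> (simp only [addrF, List.getD_cons_zero, List.getD_cons_succ, List.getD_nil]; (try rw [sel_zero hs2]); simp only [ev_rvE, ev_dum, ev_enc, ev_add, ev_sub, ev_mul, ev_div, ev_mod, ev_c, ev_cst, ev_cond, ev_eq, ev_lt, SkelExpr.NE.eval_le, ev_pow2, ev_tab1, ev_and', ev_or', ev_not', ev_bit, eKI, eSI, eAI, eBI, F.eK, F.eKK, F.eS, F.eL, F.eY, F.eII, F.eSEND, F.eNP, F.eINP, F.eOUT, F.eW, F.eS2, F.eD, F.cap, fT1, fT0, fSym, fLev, TabParams.fTim, K, N, KI, SI, AI, BI, KK, S, L, S2, D, Y, II, SEND, NP, INP, OUT, F.eN, addr_r, addr_x, addr_yp, addr_yv, addr_u, addr_h, addr_hc, addr_sw, addr_lt, addr_ae, addr_dummy, F.hn])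
    · intro h; rw [hcore]; simp only [conCore]; unfold famRecV2; rw [if_neg h]
  · -- family 2: famRecNop
    refine famOK_intro (R := si < tb.S ∧ NopSlot tb ⟨κi, hκ⟩ si) ?_ ?_ ?_
    · simp only [rangeE, ev_rvE, ev_dum, ev_enc, ev_add, ev_sub, ev_mul, ev_div, ev_mod, ev_c, ev_cst, ev_cond, ev_eq, ev_lt, SkelExpr.NE.eval_le, ev_pow2, ev_tab1, ev_and', ev_or', ev_not', ev_bit, eKI, eSI, eAI, eBI, F.eK, F.eKK, F.eS, F.eL, F.eY, F.eII, F.eSEND, F.eNP, F.eINP, F.eOUT, F.eW, F.eS2, F.eD, F.cap, fT1, fT0, fSym, fLev, TabParams.fTim, K, N, KI, SI, AI, BI, KK, S, L, S2, D, Y, II, SEND, NP, INP, OUT, F.eN, ite01_mul, ite01_or, ite01_not]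
      rw [ite01_ne_zero]; simp only [NopSlot, ne_eq, Fin.ext_iff, Fin.val_mk]
    · intro h
      refine Or.inl ⟨_, [TabVar.r ⟨κi, hκ⟩ 0 si fT1, TabVar.r ⟨κi, hκ⟩ 0 si fT0], by rw [hcore]; simp only [conCore]; unfold famRecNop; rw [if_pos h]; rfl, ?_, ?_⟩
      · simp only [ttF, ev_c]; rfl
      · intro m hm
        interval_cases m <;> simp only [addrF, List.getD_cons_zero, List.getD_cons_succ, List.getD_nil, ev_rvE, ev_dum, ev_enc, ev_add, ev_sub, ev_mul, ev_div, ev_mod, ev_c, ev_cst, ev_cond, ev_eq, ev_lt, SkelExpr.NE.eval_le, ev_pow2, ev_tab1, ev_and', ev_or', ev_not', ev_bit, eKI, eSI, eAI, eBI, F.eK, F.eKK, F.eS, F.eL, F.eY, F.eII, F.eSEND, F.eNP, F.eINP, F.eOUT, F.eW, F.eS2, F.eD, F.cap, fT1, fT0, fSym, fLev, TabParams.fTim, K, N, KI, SI, AI, BI, KK, S, L, S2, D, Y, II, SEND, NP, INP, OUT, F.eN, addr_r, addr_x, addr_yp, addr_yv, addr_u, addr_h, addr_hc, addr_sw, addr_lt,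 addr_ae, addr_dummy]
    · intro h; rw [hcore]; simp only [conCore]; unfold famRecNop; rw [if_neg h]
  · -- family 3: famRecM
    refine famOK_intro (R := tb.I ≤ si ∧ si < tb.Send ∧ ai ≤ tb.np) ?_ ?_ ?_
    · simp only [rangeE, ev_rvE, ev_dum, ev_enc, ev_add, ev_sub, ev_mul, ev_div, ev_mod, ev_c, ev_cst, ev_cond, ev_eq, ev_lt, SkelExpr.NE.eval_le, ev_pow2, ev_tab1, ev_and', ev_or', ev_not', ev_bit, eKI, eSI, eAI, eBI, F.eK, F.eKK, F.eS, F.eL, F.eY, F.eII, F.eSEND, F.eNP, F.eINP, F.eOUT, F.eW, F.eS2, F.eD, F.cap, fT1, fT0, fSym, fLev, TabParams.fTim, K, N, KI, SI, AI, BI, KK, S, L, S2, D, Y, II, SEND, NP, INP, OUT, F.eN, ite01_mul, ite01_or, ite01_not]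
      rw [ite01_ne_zero]
    · intro h
      refine Or.inl ⟨_, [TabVar.u si ai, TabVar.r ⟨κi, hκ⟩ 0 si fT1, TabVar.r ⟨κi, hκ⟩ 0 si fT0, TabVar.r ⟨κi, hκ⟩ 0 si fSym], by rw [hcore]; simp only [conCore]; unfold famRecM; rw [if_pos h]; rfl, ?_, ?_⟩
      · exact httM h
      · intro m hm
        interval_cases m <;> simp only [addrF, List.getD_cons_zero, List.getD_cons_succ, List.getD_nil, ev_rvE, ev_dum, ev_enc, ev_add, ev_sub, ev_mul, ev_div, ev_mod, ev_c, ev_cst, ev_cond, ev_eq, ev_lt, SkelExpr.NE.eval_le, ev_pow2, ev_tab1, ev_and', ev_or', ev_not', ev_bit, eKI, eSI, eAI, eBI, F.eK, F.eKK, F.eS, F.eL, F.eY, F.eII, F.eSEND, F.eNP, F.eINP, F.eOUT, F.eW, F.eS2, F.eD, F.cap, fT1, fT0, fSym, fLev, TabParams.fTim, K, N, KI, SI, AI, BI, KK, S, L, S2, D, Y, II, SEND, NP, INP, OUT, F.eN, addr_r, addr_x, addr_yp, addr_yv, addr_u, addr_h, addr_hc, addr_sw, addr_lt, addr_ae, 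addr_dummy]
    · intro h; rw [hcore]; simp only [conCore]; unfold famRecM; rw [if_neg h]
  · -- family 4: famRecF
    refine famOK_intro (R := True) ?_ ?_ ?_
    · simp only [rangeE, ev_c]; simp
    · intro h
      refine Or.inl ⟨_, [TabVar.r tb.out 0 tb.Send fT1, TabVar.r tb.out 0 tb.Send fT0, TabVar.r tb.out 0 tb.Send fSym], by rw [hcore]; simp only [conCore]; unfold famRecF; rfl, ?_, ?_⟩
      · simp only [ttF, ev_c]; rfl
      · intro m hm
        interval_cases m <;> simp only [addrF, List.getD_cons_zero, List.getD_cons_succ, List.getD_nil, ev_rvE, ev_dum, ev_enc, ev_add, ev_sub, ev_mul, ev_div, ev_mod, ev_c, ev_cst, ev_cond, ev_eq, ev_lt, SkelExpr.NE.eval_le, ev_pow2, ev_tab1, ev_and', ev_or', ev_not', ev_bit, eKI, eSI, eAI, eBI, F.eK, F.eKK, F.eS, F.eL, F.eY, F.eII, F.eSEND, F.eNP, F.eINP, F.eOUT, F.eW, F.eS2, F.eD, F.cap, fT1, fT0, fSym, fLev, TabParams.fTim, K, N, KI, SI, AI, BI, KK, S, L, S2, D, Y, II, SEND, NP, INP,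 OUT, F.eN, addr_r, addr_x, addr_yp, addr_yv, addr_u, addr_h, addr_hc, addr_sw, addr_lt, addr_ae, addr_dummy]
    · intro h; exact absurd trivial h
  · -- family 5: famTime
    refine famOK_intro (R := si < tb.S ∧ ai < tb.k) ?_ ?_ ?_
    · simp only [rangeE, ev_rvE, ev_dum, ev_enc, ev_add, ev_sub, ev_mul, ev_div, ev_mod, ev_c, ev_cst, ev_cond, ev_eq, ev_lt, SkelExpr.NE.eval_le, ev_pow2, ev_tab1, ev_and', ev_or', ev_not', ev_bit, eKI, eSI, eAI, eBI, F.eK, F.eKK, F.eS, F.eL, F.eY, F.eII, F.eSEND, F.eNP, F.eINP, F.eOUT, F.eW, F.eS2, F.eD, F.cap, fT1, fT0, fSym, fLev, TabParams.fTim, K, N, KI, SI, AI, BI, KK, S, L, S2, D, Y, II, SEND, NP, INP, OUT, F.eN, ite01_mul, ite01_or, ite01_not]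
      rw [ite01_ne_zero]
    · intro h
      refine Or.inl ⟨_, [TabVar.r ⟨κi, hκ⟩ 0 si (tb.fTim ai)], by rw [hcore]; simp only [conCore]; unfold famTime; rw [if_pos h]; rfl, ?_, ?_⟩
      · simp only [ttF, ev_cond, ev_bit, ev_c, eAI, eSI, AI, SI, F.cap]
        rw [min_eq_left (by omega)]
        unfold ttV1 ttV0 ThreeCNF.bit
        rcases Nat.mod_two_eq_zero_or_one (si / 2 ^ ai) with hb | hb <;> simp [hb]
      · intro m hm
        interval_cases m <;> simp only [addrF, List.getD_cons_zero, List.getD_cons_succ, List.getD_nil, ev_rvE, ev_dum, ev_enc, ev_add, ev_sub, ev_mul, ev_div, ev_mod, ev_c, ev_cst, ev_cond, ev_eq, ev_lt, SkelExpr.NE.eval_le, ev_pow2, ev_tab1, ev_and', ev_or', ev_not', ev_bit, eKI, eSI, eAI, eBI, F.eK, F.eKK, F.eS, F.eL, F.eY, F.eII, F.eSEND, F.eNP, F.eINP, F.eOUT, F.eW, F.eS2, F.eD, F.cap, fT1, fT0, fSym, fLev, TabParams.fTim, K, N, KI, SI, AI, BI, KK, S, L, S2, D, Y, II, SEND, NP,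 INP, OUT, F.eN, addr_r, addr_x, addr_yp, addr_yv, addr_u, addr_h, addr_hc, addr_sw, addr_lt, addr_ae, addr_dummy]
    · intro h; rw [hcore]; simp only [conCore]; unfold famTime; rw [if_neg h]
  · -- family 6: famLev
    refine famOK_intro (R := si < tb.S ∧ ai ≤ tb.k) ?_ ?_ ?_
    · simp only [rangeE, ev_rvE, ev_dum, ev_enc, ev_add, ev_sub, ev_mul, ev_div, ev_mod, ev_c, ev_cst, ev_cond, ev_eq, ev_lt, SkelExpr.NE.eval_le, ev_pow2, ev_tab1, ev_and', ev_or', ev_not', ev_bit, eKI, eSI, eAI, eBI, F.eK, F.eKK, F.eS, F.eL, F.eY, F.eII, F.eSEND, F.eNP, F.eINP, F.eOUT, F.eW, F.eS2, F.eD, F.cap, fT1, fT0, fSym, fLev, TabParams.fTim, K, N, KI, SI, AI, BI, KK, S, L, S2, D, Y, II, SEND, NP, INP, OUT, F.eN, ite01_mul, ite01_or, ite01_not]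
      rw [ite01_ne_zero]
    · intro h
      refine Or.inl ⟨_, [TabVar.r ⟨κi, hκ⟩ 0 si fT1, TabVar.r ⟨κi, hκ⟩ 0 si fT0, TabVar.r ⟨κi, hκ⟩ 0 si (fLev ai), TabVar.h ⟨κi, hκ⟩ (si + 1) ai, TabVar.h ⟨κi, hκ⟩ si ai], by rw [hcore]; simp only [conCore]; unfold famLev; rw [if_pos h]; rfl, ?_, ?_⟩
      · simp only [ttF, ev_c]; rfl
      · intro m hm
        interval_cases m <;> simp only [addrF, List.getD_cons_zero, List.getD_cons_succ, List.getD_nil, ev_rvE, ev_dum, ev_enc, ev_add, ev_sub, ev_mul, ev_div, ev_mod, ev_c, ev_cst, ev_cond, ev_eq, ev_lt, SkelExpr.NE.eval_le, ev_pow2, ev_tab1, ev_and', ev_or', ev_not', ev_bit, eKI, eSI, eAI, eBI, F.eK, F.eKK, F.eS, F.eL, F.eY, F.eII, F.eSEND, F.eNP, F.eINP, F.eOUT, F.eW, F.eS2, F.eD, F.cap, fT1, fT0, fSym, fLev, TabParams.fTim, K, N, KI, SI, AI, BI, KK, S, L, S2, D, Y, II, SEND, NP, INP, OUT, F.eN,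 addr_r, addr_x, addr_yp, addr_yv, addr_u, addr_h, addr_hc, addr_sw, addr_lt, addr_ae, addr_dummy]
    · intro h; rw [hcore]; simp only [conCore]; unfold famLev; rw [if_neg h]
  · -- family 7: famH0
    refine famOK_intro (R := ai ≤ tb.k) ?_ ?_ ?_
    · simp only [rangeE, ev_rvE, ev_dum, ev_enc, ev_add, ev_sub, ev_mul, ev_div, ev_mod, ev_c, ev_cst, ev_cond, ev_eq, ev_lt, SkelExpr.NE.eval_le, ev_pow2, ev_tab1, ev_and', ev_or', ev_not', ev_bit, eKI, eSI, eAI, eBI, F.eK, F.eKK, F.eS, F.eL, F.eY, F.eII, F.eSEND, F.eNP, F.eINP, F.eOUT, F.eW, F.eS2, F.eD, F.cap, fT1, fT0, fSym, fLev, TabParams.fTim, K, N, KI, SI, AI, BI, KK, S, L, S2, D, Y, II, SEND, NP, INP, OUT, F.eN, ite01_mul, ite01_or, ite01_not]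
      rw [ite01_ne_zero]
    · intro h
      refine Or.inl ⟨_, [TabVar.h ⟨κi, hκ⟩ 0 ai], by rw [hcore]; simp only [conCore]; unfold famH0; rw [if_pos h]; rfl, ?_, ?_⟩
      · simp only [ttF, ev_c]; rfl
      · intro m hm
        interval_cases m <;> simp only [addrF, List.getD_cons_zero, List.getD_cons_succ, List.getD_nil, ev_rvE, ev_dum, ev_enc, ev_add, ev_sub, ev_mul, ev_div, ev_mod, ev_c, ev_cst, ev_cond, ev_eq, ev_lt, SkelExpr.NE.eval_le, ev_pow2, ev_tab1, ev_and', ev_or', ev_not', ev_bit, eKI, eSI, eAI, eBI, F.eK, F.eKK, F.eS, F.eL, F.eY, F.eII, F.eSEND, F.eNP, F.eINP, F.eOUT, F.eW, F.eS2, F.eD, F.cap, fT1, fT0, fSym, fLev, TabParams.fTim, K, N, KI, SI, AI, BI, KK, S, L, S2, D, Y, II, SEND, NP, INP, OUT, F.eN, addr_r, addr_x, addr_yp, addr_yv, addr_u, addr_h, addr_hc, addr_sw, addr_lt, addr_ae, addr_dummy]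
    · intro h; rw [hcore]; simp only [conCore]; unfold famH0; rw [if_neg h]
  · -- family 8: famHc0
    refine famOK_intro (R := si < tb.S) ?_ ?_ ?_
    · simp only [rangeE, ev_rvE, ev_dum, ev_enc, ev_add, ev_sub, ev_mul, ev_div, ev_mod, ev_c, ev_cst, ev_cond, ev_eq, ev_lt, SkelExpr.NE.eval_le, ev_pow2, ev_tab1, ev_and', ev_or', ev_not', ev_bit, eKI, eSI, eAI, eBI, F.eK, F.eKK, F.eS, F.eL, F.eY, F.eII, F.eSEND, F.eNP, F.eINP, F.eOUT, F.eW, F.eS2, F.eD, F.cap, fT1, fT0, fSym, fLev, TabParams.fTim, K, N, KI, SI, AI, BI, KK, S, L, S2, D, Y, II, SEND, NP, INP, OUT, F.eN, ite01_mul, ite01_or, ite01_not]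
      rw [ite01_ne_zero]
    · intro h
      refine Or.inl ⟨_, [TabVar.hc ⟨κi, hκ⟩ si 0], by rw [hcore]; simp only [conCore]; unfold famHc0; rw [if_pos h]; rfl, ?_, ?_⟩
      · simp only [ttF, ev_c]; rfl
      · intro m hm
        interval_cases m <;> simp only [addrF, List.getD_cons_zero, List.getD_cons_succ, List.getD_nil, ev_rvE, ev_dum, ev_enc, ev_add, ev_sub, ev_mul, ev_div, ev_mod, ev_c, ev_cst, ev_cond, ev_eq, ev_lt, SkelExpr.NE.eval_le, ev_pow2, ev_tab1, ev_and', ev_or', ev_not', ev_bit, eKI, eSI, eAI, eBI, F.eK, F.eKK, F.eS, F.eL, F.eY, F.eII, F.eSEND, F.eNP, F.eINP, F.eOUT, F.eW, F.eS2, F.eD, F.cap, fT1, fT0, fSym, fLev, TabParams.fTim, K, N, KI, SI, AI, BI, KK, S, L, S2, D, Y, II, SEND, NP, INP, OUT, F.eN, addr_r, addr_x, addr_yp, addr_yv, addr_u, addr_h, addr_hc, addr_sw, addr_lt, addr_ae, addr_dummy]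
    · intro h; rw [hcore]; simp only [conCore]; unfold famHc0; rw [if_neg h]
  · -- family 9: famHcK
    refine famOK_intro (R := si < tb.S) ?_ ?_ ?_
    · simp only [rangeE, ev_rvE, ev_dum, ev_enc, ev_add, ev_sub, ev_mul, ev_div, ev_mod, ev_c, ev_cst, ev_cond, ev_eq, ev_lt, SkelExpr.NE.eval_le, ev_pow2, ev_tab1, ev_and', ev_or', ev_not', ev_bit, eKI, eSI, eAI, eBI, F.eK, F.eKK, F.eS, F.eL, F.eY, F.eII, F.eSEND, F.eNP, F.eINP, F.eOUT, F.eW, F.eS2, F.eD, F.cap, fT1, fT0, fSym, fLev, TabParams.fTim, K, N, KI, SI, AI, BI, KK, S, L, S2, D, Y, II, SEND, NP, INP, OUT, F.eN, ite01_mul, ite01_or, ite01_not]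
      rw [ite01_ne_zero]
    · intro h
      refine Or.inl ⟨_, [TabVar.r ⟨κi, hκ⟩ 0 si fT0, TabVar.hc ⟨κi, hκ⟩ si (tb.k + 1)], by rw [hcore]; simp only [conCore]; unfold famHcK; rw [if_pos h]; rfl, ?_, ?_⟩
      · simp only [ttF, ev_c]; rfl
      · intro m hm
        interval_cases m <;> simp only [addrF, List.getD_cons_zero, List.getD_cons_succ, List.getD_nil, ev_rvE, ev_dum, ev_enc, ev_add, ev_sub, ev_mul, ev_div, ev_mod, ev_c, ev_cst, ev_cond, ev_eq, ev_lt, SkelExpr.NE.eval_le, ev_pow2, ev_tab1, ev_and', ev_or', ev_not', ev_bit, eKI, eSI, eAI, eBI, F.eK, F.eKK, F.eS, F.eL, F.eY, F.eII, F.eSEND, F.eNP, F.eINP, F.eOUT, F.eW, F.eS2, F.eD, F.cap, fT1, fT0, fSym, fLev, TabParams.fTim, K, N, KI, SI, AI, BI, KK, S, L, S2, D, Y, II, SEND, NP, INP, OUT, F.eN, addr_r, addr_x, addr_yp, addr_yv, addr_u, addr_h, addr_hc, addr_sw, addr_lt, addr_ae, addr_dummy]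
    · intro h; rw [hcore]; simp only [conCore]; unfold famHcK; rw [if_neg h]
  · -- family 10: famHstep
    refine famOK_intro (R := si < tb.S ∧ ai ≤ tb.k) ?_ ?_ ?_
    · simp only [rangeE, ev_rvE, ev_dum, ev_enc, ev_add, ev_sub, ev_mul, ev_div, ev_mod, ev_c, ev_cst, ev_cond, ev_eq, ev_lt, SkelExpr.NE.eval_le, ev_pow2, ev_tab1, ev_and', ev_or', ev_not', ev_bit, eKI, eSI, eAI, eBI, F.eK, F.eKK, F.eS, F.eL, F.eY, F.eII, F.eSEND, F.eNP, F.eINP, F.eOUT, F.eW, F.eS2, F.eD, F.cap, fT1, fT0, fSym, fLev, TabParams.fTim, K, N, KI, SI, AI, BI, KK, S, L, S2, D, Y, II, SEND, NP, INP, OUT, F.eN, ite01_mul, ite01_or, ite01_not]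
      rw [ite01_ne_zero]
    · intro h
      refine Or.inl ⟨_, [TabVar.r ⟨κi, hκ⟩ 0 si fT1, TabVar.r ⟨κi, hκ⟩ 0 si fT0, TabVar.h ⟨κi, hκ⟩ si ai, TabVar.hc ⟨κi, hκ⟩ si ai, TabVar.h ⟨κi, hκ⟩ (si + 1) ai, TabVar.hc ⟨κi, hκ⟩ si (ai + 1)], by rw [hcore]; simp only [conCore]; unfold famHstep; rw [if_pos h]; rfl, ?_, ?_⟩
      · simp only [ttF, ev_c]; rfl
      · intro m hm
        interval_cases m <;> simp only [addrF, List.getD_cons_zero, List.getD_cons_succ, List.getD_nil, ev_rvE, ev_dum, ev_enc, ev_add, ev_sub, ev_mul, ev_div, ev_mod, ev_c, ev_cst, ev_cond, ev_eq, ev_lt, SkelExpr.NE.eval_le, ev_pow2, ev_tab1, ev_and', ev_or', ev_not', ev_bit, eKI, eSI, eAI, eBI, F.eK, F.eKK, F.eS, F.eL, F.eY, F.eII, F.eSEND, F.eNP, F.eINP, F.eOUT, F.eW, F.eS2, F.eD, F.cap, fT1, fT0, fSym, fLev, TabParams.fTim, K, N, KI, SI, AI, BI, KK, S, L, S2, D,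 Y, II, SEND, NP, INP, OUT, F.eN, addr_r, addr_x, addr_yp, addr_yv, addr_u, addr_h, addr_hc, addr_sw, addr_lt, addr_ae, addr_dummy]
    · intro h; rw [hcore]; simp only [conCore]; unfold famHstep; rw [if_neg h]
  · -- family 11: famU0
    refine famOK_intro (R := True) ?_ ?_ ?_
    · simp only [rangeE, ev_c]; simp
    · intro h
      refine Or.inl ⟨_, [TabVar.u tb.I 0], by rw [hcore]; simp only [conCore]; unfold famU0; rfl, ?_, ?_⟩
      · simp only [ttF, ev_c]; rfl
      · intro m hm
        interval_cases m <;> simp only [addrF, List.getD_cons_zero, List.getD_cons_succ, List.getD_nil, ev_rvE, ev_dum, ev_enc, ev_add, ev_sub, ev_mul, ev_div, ev_mod, ev_c, ev_cst, ev_cond, ev_eq, ev_lt, SkelExpr.NE.eval_le, ev_pow2, ev_tab1, ev_and', ev_or', ev_not', ev_bit, eKI, eSI, eAI, eBI, F.eK, F.eKK, F.eS, F.eL, F.eY, F.eII, F.eSEND, F.eNP, F.eINP, F.eOUT, F.eW, F.eS2, F.eD, F.cap, fT1, fT0, fSym, fLev, TabParams.fTim, K, N, KI, SI, AI, BI, KK,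 S, L, S2, D, Y, II, SEND, NP, INP, OUT, F.eN, addr_r, addr_x, addr_yp, addr_yv, addr_u, addr_h, addr_hc, addr_sw, addr_lt, addr_ae, addr_dummy]
    · intro h; exact absurd trivial h
  · -- family 12: famU2
    refine famOK_intro (R := tb.I ≤ si ∧ si ≤ tb.Send ∧ ai < bi ∧ bi ≤ tb.np) ?_ ?_ ?_
    · simp only [rangeE, ev_rvE, ev_dum, ev_enc, ev_add, ev_sub, ev_mul, ev_div, ev_mod, ev_c, ev_cst, ev_cond, ev_eq, ev_lt, SkelExpr.NE.eval_le, ev_pow2, ev_tab1, ev_and', ev_or', ev_not', ev_bit, eKI, eSI, eAI, eBI, F.eK, F.eKK, F.eS, F.eL, F.eY, F.eII, F.eSEND, F.eNP, F.eINP, F.eOUT, F.eW, F.eS2, F.eD, F.cap, fT1, fT0, fSym, fLev, TabParams.fTim, K, N, KI, SI, AI, BI, KK, S, L, S2, D, Y, II, SEND, NP, INP, OUT, F.eN, ite01_mul, ite01_or, ite01_not]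
      rw [ite01_ne_zero]
    · intro h
      refine Or.inl ⟨_, [TabVar.u si ai, TabVar.u si bi], by rw [hcore]; simp only [conCore]; unfold famU2; rw [if_pos h]; rfl, ?_, ?_⟩
      · simp only [ttF, ev_c]; rfl
      · intro m hm
        interval_cases m <;> simp only [addrF, List.getD_cons_zero, List.getD_cons_succ, List.getD_nil, ev_rvE, ev_dum, ev_enc, ev_add, ev_sub, ev_mul, ev_div, ev_mod, ev_c, ev_cst, ev_cond, ev_eq, ev_lt, SkelExpr.NE.eval_le, ev_pow2, ev_tab1, ev_and', ev_or', ev_not', ev_bit, eKI, eSI, eAI, eBI, F.eK, F.eKK, F.eS, F.eL, F.eY, F.eII, F.eSEND, F.eNP, F.eINP, F.eOUT, F.eW, F.eS2, F.eD, F.cap, fT1, fT0, fSym, fLev, TabParams.fTim, K, N, KI, SI, AI, BI, KK, S, L, S2, D, Y, II, SEND, NP, INP, OUT, F.eN, addr_r, addr_x, addr_yp, addr_yv, addr_u, addr_h, addr_hc, addr_sw, addr_lt, addr_ae, addr_dummy]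
    · intro h; rw [hcore]; simp only [conCore]; unfold famU2; rw [if_neg h]
  · -- family 13: famTr
    refine famOK_intro (R := tb.I ≤ si ∧ si < tb.Send ∧ ai ≤ tb.np ∧ bi < 3) ?_ ?_ ?_
    · simp only [rangeE, ev_rvE, ev_dum, ev_enc, ev_add, ev_sub, ev_mul, ev_div, ev_mod, ev_c, ev_cst, ev_cond, ev_eq, ev_lt, SkelExpr.NE.eval_le, ev_pow2, ev_tab1, ev_and', ev_or', ev_not', ev_bit, eKI, eSI, eAI, eBI, F.eK, F.eKK, F.eS, F.eL, F.eY, F.eII, F.eSEND, F.eNP, F.eINP, F.eOUT, F.eW, F.eS2, F.eD, F.cap, fT1, fT0, fSym, fLev, TabParams.fTim, K, N, KI, SI, AI, BI, KK, S, L, S2, D, Y, II, SEND, NP, INP, OUT, F.eN, ite01_mul, ite01_or, ite01_not]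
      rw [ite01_ne_zero]
    · rintro ⟨h1, h2, hq, ho⟩
      have h := And.intro h1 (And.intro h2 (And.intro hq ho))
      have hrow : x.2.2.1.getD ai [] = irow tb.P ai := by rw [F.itab]; exact itab_getD hq
      have ek : eval kindE x = (irow tb.P ai).getD 0 0 := by rw [kindE, ev_tab1, eAI', ev_c, hrow]
      have er : eval regE x = (irow tb.P ai).getD 1 0 := by rw [regE, ev_tab1, eAI', ev_c, hrow]
      have et0 : eval tgt0E x = (irow tb.P ai).getD 3 0 := by rw [tgt0E, ev_tab1, eAI', ev_c, hrow]
      have et : eval tgtE x = (irow tb.P ai).getD (3 + bi) 0 := by rw [tgtE, ev_tab1, eAI', ev_add, ev_c, eBI', hrow]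
      unfold irow at ek er et0 et
      rcases hPq : tb.P[ai]? with _ | ⟨k', a⟩ | ⟨k', j⟩ | ⟨j⟩ <;> simp only [hPq, List.getD_cons_zero, List.getD_cons_succ, List.getD_nil] at ek er et0 et
      -- pop
      rotate_left 2
      · have htg : eval tgtE x = target tb ai (oPat bi) := by
          rw [et]; unfold target oPat; rw [hPq]
          interval_cases bi <;> rfl
        have hk2 : eval kindE x = 2 := ek
        refine Or.inl ⟨_, [TabVar.u si ai, TabVar.r k' 0 si fT0, TabVar.r k' 0 si fSym,
          (if target tb ai (oPat bi) ≤ tb.np then TabVar.u (si + 1) (target tb ai (oPat bi)) else TabVar.dummy)], by rw [hcore]; simp only [conCore]; unfold famTr; rw [if_pos h]; simp only [hPq]; rfl, ?_, ?_⟩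
        · simp only [ttF]
          rw [sel_pos (by rw [ev_eq, hk2, ev_c]; decide)]
          by_cases htn : target tb ai (oPat bi) ≤ tb.np
          · rw [sel_pos (by rw [SkelExpr.NE.eval_le, htg, F.eNP'']; simp [htn])]
            interval_cases bi
            · rw [sel_pos (by rw [ev_eq, eBI', ev_c]; decide), ev_c]; unfold ttTrPopA; apply ttOf_congr; intros; simp [htn]
            · rw [sel_zero (by rw [ev_eq, eBI', ev_c]; decide), sel_pos (by rw [ev_eq, eBI', ev_c]; decide), ev_c]
              unfold ttTrPopA; apply ttOf_congr; intros; simp [htn]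
            · rw [sel_zero (by rw [ev_eq, eBI', ev_c]; decide), sel_zero (by rw [ev_eq, eBI', ev_c]; decide), ev_c]
              unfold ttTrPopA; apply ttOf_congr; intros; simp [htn]
          · rw [sel_zero (by rw [SkelExpr.NE.eval_le, htg, F.eNP'']; simp [htn])]
            interval_cases bi
            · rw [sel_pos (by rw [ev_eq, eBI', ev_c]; decide), ev_c]; unfold ttTrPopB; apply ttOf_congr; intros; simp [htn]
            · rw [sel_zero (by rw [ev_eq, eBI', ev_c]; decide), sel_pos (by rw [ev_eq, eBI', ev_c]; decide), ev_c]
              unfold ttTrPopB; apply ttOf_congr; intros; simp [htn]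
            · rw [sel_zero (by rw [ev_eq, eBI', ev_c]; decide), sel_zero (by rw [ev_eq, eBI', ev_c]; decide), ev_c]
              unfold ttTrPopB; apply ttOf_congr; intros; simp [htn]
        · intro m hm
          have hreg : eval regE x = k'.val := er
          interval_cases m
          · simp only [addrF, List.getD_cons_zero, List.getD_cons_succ, List.getD_nil, ev_rvE, ev_dum, ev_enc, ev_add, ev_sub, ev_mul, ev_div, ev_mod, ev_c, ev_cst, ev_cond, ev_eq, ev_lt, SkelExpr.NE.eval_le, ev_pow2, ev_tab1, ev_and', ev_or', ev_not', ev_bit, eKI, eSI, eAI, eBI, F.eK, F.eKK, F.eS, F.eL, F.eY, F.eII, F.eSEND, F.eNP, F.eINP, F.eOUT, F.eW, F.eS2, F.eD, F.cap, fT1, fT0, fSym, fLev, TabParams.fTim, K, N, KI, SI, AI, BI, KK, S, L, S2, D, Y, II, SEND, NP, INP, OUT, F.eN, addr_r, addr_x, addr_yp, addr_yv, addr_u, addr_h, addr_hc, addr_sw, addr_lt, addr_ae, addr_dummy]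
          · simp only [addrF, List.getD_cons_zero, List.getD_cons_succ, List.getD_nil]; rw [sel_pos (by rw [ev_eq, hk2, ev_c]; decide)]
            simp only [ev_rvE, ev_dum, ev_enc, ev_add, ev_sub, ev_mul, ev_div, ev_mod, ev_c, ev_cst, ev_cond, ev_eq, ev_lt, SkelExpr.NE.eval_le, ev_pow2, ev_tab1, ev_and', ev_or', ev_not', ev_bit, eKI, eSI, eAI, eBI, F.eK, F.eKK, F.eS, F.eL, F.eY, F.eII, F.eSEND, F.eNP, F.eINP, F.eOUT, F.eW, F.eS2, F.eD, F.cap, fT1, fT0, fSym, fLev, TabParams.fTim, K, N, KI, SI, AI, BI, KK, S, L, S2, D, Y, II, SEND, NP, INP, OUT, F.eN, hreg, addr_r, addr_x, addr_yp, addr_yv, addr_u, addr_h, addr_hc, addr_sw, addr_lt, addr_ae, addr_dummy]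
          · simp only [addrF, List.getD_cons_zero, List.getD_cons_succ, List.getD_nil]; rw [sel_pos (by rw [ev_eq, hk2, ev_c]; decide)]
            simp only [ev_rvE, ev_dum, ev_enc, ev_add, ev_sub, ev_mul, ev_div, ev_mod, ev_c, ev_cst, ev_cond, ev_eq, ev_lt, SkelExpr.NE.eval_le, ev_pow2, ev_tab1, ev_and', ev_or', ev_not', ev_bit, eKI, eSI, eAI, eBI, F.eK, F.eKK, F.eS, F.eL, F.eY, F.eII, F.eSEND, F.eNP, F.eINP, F.eOUT, F.eW, F.eS2, F.eD, F.cap, fT1, fT0, fSym, fLev, TabParams.fTim, K, N, KI, SI, AI, BI, KK, S, L, S2, D, Y, II, SEND, NP, INP, OUT, F.eN, hreg, addr_r, addr_x, addr_yp, addr_yv, addr_u, addr_h, addr_hc, addr_sw, addr_lt, addr_ae, addr_dummy]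
          · simp only [addrF, List.getD_cons_zero, List.getD_cons_succ, List.getD_nil]; rw [sel_pos (by rw [ev_eq, hk2, ev_c]; decide)]
            by_cases htn : target tb ai (oPat bi) ≤ tb.np
            · rw [sel_pos (by rw [SkelExpr.NE.eval_le, htg, F.eNP'']; simp [htn]), if_pos htn]
              simp only [ev_rvE, ev_dum, ev_enc, ev_add, ev_sub, ev_mul, ev_div, ev_mod, ev_c, ev_cst, ev_cond, ev_eq, ev_lt, SkelExpr.NE.eval_le, ev_pow2, ev_tab1, ev_and', ev_or', ev_not', ev_bit, eKI, eSI, eAI, eBI, F.eK, F.eKK, F.eS, F.eL, F.eY, F.eII, F.eSEND, F.eNP, F.eINP, F.eOUT, F.eW, F.eS2, F.eD, F.cap, fT1, fT0, fSym, fLev, TabParams.fTim, K, N, KI, SI, AI, BI, KK, S, L, S2, D, Y, II, SEND, NP, INP, OUT, F.eN, htg, addr_r, addr_x, addr_yp, addr_yv, addr_u, addr_h, addr_hc, addr_sw, addr_lt, addr_ae, addr_dummy]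
            · rw [sel_zero (by rw [SkelExpr.NE.eval_le, htg, F.eNP'']; simp [htn]), if_neg htn]
              simp only [ev_rvE, ev_dum, ev_enc, ev_add, ev_sub, ev_mul, ev_div, ev_mod, ev_c, ev_cst, ev_cond, ev_eq, ev_lt, SkelExpr.NE.eval_le, ev_pow2, ev_tab1, ev_and', ev_or', ev_not', ev_bit, eKI, eSI, eAI, eBI, F.eK, F.eKK, F.eS, F.eL, F.eY, F.eII, F.eSEND, F.eNP, F.eINP, F.eOUT, F.eW, F.eS2, F.eD, F.cap, fT1, fT0, fSym, fLev, TabParams.fTim, K, N, KI, SI, AI, BI, KK, S, L, S2, D, Y, II, SEND, NP, INP, OUT, F.eN, addr_r, addr_x, addr_yp, addr_yv, addr_u, addr_h, addr_hc, addr_sw, addr_lt, addr_ae, addr_dummy]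
          all_goals simp only [addrF, List.getD_cons_zero, List.getD_cons_succ, List.getD_nil, ev_rvE, ev_dum, ev_enc, ev_add, ev_sub, ev_mul, ev_div, ev_mod, ev_c, ev_cst, ev_cond, ev_eq, ev_lt, SkelExpr.NE.eval_le, ev_pow2, ev_tab1, ev_and', ev_or', ev_not', ev_bit, eKI, eSI, eAI, eBI, F.eK, F.eKK, F.eS, F.eL, F.eY, F.eII, F.eSEND, F.eNP, F.eINP, F.eOUT, F.eW, F.eS2, F.eD, F.cap, fT1, fT0, fSym, fLev, TabParams.fTim, K, N, KI, SI, AI, BI, KK, S, L, S2, D, Y, II, SEND, NP, INP, OUT, F.eN, addr_r, addr_x, addr_yp, addr_yv, addr_u, addr_h, addr_hc, addr_sw, addr_lt, addr_ae, addr_dummy]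
      -- none, push, goto: not a pop
      all_goals
        have hk2 : eval kindE x ≠ 2 := by rw [ek]; decide
        have htg : eval tgt0E x = target tb ai none := by rw [et0]; unfold target; rw [hPq]
        by_cases ho0 : bi = 0
        · refine Or.inl ⟨_, [TabVar.u si ai,
            (if target tb ai none ≤ tb.np then TabVar.u (si + 1) (target tb ai none) else TabVar.dummy)], by rw [hcore]; simp only [conCore]; unfold famTr; rw [if_pos h]; simp only [hPq, ho0, if_true]; rfl, ?_, ?_⟩
          · simp only [ttF]
            rw [sel_zero (by rw [ev_eq, ev_c]; simp [hk2]), sel_pos (by rw [ev_eq, eBI', ev_c, ho0]; decide)]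
            by_cases htn : target tb ai none ≤ tb.np
            · rw [sel_pos (by rw [SkelExpr.NE.eval_le, htg, F.eNP'']; simp [htn]), ev_c]
              unfold ttTrA; apply ttOf_congr; intros; simp [htn]
            · rw [sel_zero (by rw [SkelExpr.NE.eval_le, htg, F.eNP'']; simp [htn]), ev_c]
              unfold ttTrB; apply ttOf_congr; intros; simp [htn]
          · intro m hm
            interval_cases m
            · simp only [addrF, List.getD_cons_zero, List.getD_cons_succ, List.getD_nil, ev_rvE, ev_dum, ev_enc, ev_add, ev_sub, ev_mul, ev_div, ev_mod, ev_c, ev_cst, ev_cond, ev_eq, ev_lt, SkelExpr.NE.eval_le, ev_pow2, ev_tab1, ev_and', ev_or', ev_not', ev_bit, eKI, eSI, eAI, eBI, F.eK, F.eKK, F.eS, F.eL, F.eY, F.eII, F.eSEND, F.eNP, F.eINP, F.eOUT, F.eW, F.eS2, F.eD, F.cap, fT1, fT0, fSym, fLev, TabParams.fTim, K, N, KI, SI, AI, BI, KK, S, L, S2, D, Y, II, SEND, NP, INP, OUT, F.eN, addr_r, addr_x, addr_yp, addr_yv, addr_u, addr_h, addr_hc, addr_sw, addr_lt, addr_ae,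 addr_dummy]
            · simp only [addrF, List.getD_cons_zero, List.getD_cons_succ, List.getD_nil]; rw [sel_zero (by rw [ev_eq, ev_c]; simp [hk2])]
              by_cases htn : target tb ai none ≤ tb.np
              · rw [sel_pos (by rw [SkelExpr.NE.eval_le, htg, F.eNP'']; simp [htn]), if_pos htn]
                simp only [ev_rvE, ev_dum, ev_enc, ev_add, ev_sub, ev_mul, ev_div, ev_mod, ev_c, ev_cst, ev_cond, ev_eq, ev_lt, SkelExpr.NE.eval_le, ev_pow2, ev_tab1, ev_and', ev_or', ev_not', ev_bit, eKI, eSI, eAI, eBI, F.eK, F.eKK, F.eS, F.eL, F.eY, F.eII, F.eSEND, F.eNP, F.eINP, F.eOUT, F.eW, F.eS2, F.eD, F.cap, fT1, fT0, fSym, fLev, TabParams.fTim, K, N, KI, SI, AI, BI, KK, S, L, S2, D, Y, II, SEND, NP, INP, OUT, F.eN, htg, addr_r, addr_x, addr_yp, addr_yv, addr_u, addr_h, addr_hc, addr_sw, addr_lt, addr_ae, addr_dummy]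
              · rw [sel_zero (by rw [SkelExpr.NE.eval_le, htg, F.eNP'']; simp [htn]), if_neg htn]
                simp only [ev_rvE, ev_dum, ev_enc, ev_add, ev_sub, ev_mul, ev_div, ev_mod, ev_c, ev_cst, ev_cond, ev_eq, ev_lt, SkelExpr.NE.eval_le, ev_pow2, ev_tab1, ev_and', ev_or', ev_not', ev_bit, eKI, eSI, eAI, eBI, F.eK, F.eKK, F.eS, F.eL, F.eY, F.eII, F.eSEND, F.eNP, F.eINP, F.eOUT, F.eW, F.eS2, F.eD, F.cap, fT1, fT0, fSym, fLev, TabParams.fTim, K, N, KI, SI, AI, BI, KK, S, L, S2, D, Y, II, SEND, NP, INP, OUT, F.eN, addr_r, addr_x, addr_yp, addr_yv, addr_u, addr_h, addr_hc, addr_sw, addr_lt, addr_ae, addr_dummy]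
            · simp only [addrF, List.getD_cons_zero, List.getD_cons_succ, List.getD_nil]; rw [sel_zero (by rw [ev_eq, ev_c]; simp [hk2])]; simp only [ev_rvE, ev_dum, ev_enc, ev_add, ev_sub, ev_mul, ev_div, ev_mod, ev_c, ev_cst, ev_cond, ev_eq, ev_lt, SkelExpr.NE.eval_le, ev_pow2, ev_tab1, ev_and', ev_or', ev_not', ev_bit, eKI, eSI, eAI, eBI, F.eK, F.eKK, F.eS, F.eL, F.eY, F.eII, F.eSEND, F.eNP, F.eINP, F.eOUT, F.eW, F.eS2, F.eD, F.cap, fT1, fT0, fSym, fLev, TabParams.fTim, K, N, KI, SI, AI, BI, KK, S, L, S2, D, Y, II, SEND, NP, INP, OUT, F.eN, addr_r, addr_x, addr_yp, addr_yv, addr_u, addr_h, addr_hc, addr_sw, addr_lt, addr_ae, addr_dummy]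
            · simp only [addrF, List.getD_cons_zero, List.getD_cons_succ, List.getD_nil]; rw [sel_zero (by rw [ev_eq, ev_c]; simp [hk2])]; simp only [ev_rvE, ev_dum, ev_enc, ev_add, ev_sub, ev_mul, ev_div, ev_mod, ev_c, ev_cst, ev_cond, ev_eq, ev_lt, SkelExpr.NE.eval_le, ev_pow2, ev_tab1, ev_and', ev_or', ev_not', ev_bit, eKI, eSI, eAI, eBI, F.eK, F.eKK, F.eS, F.eL, F.eY, F.eII, F.eSEND, F.eNP, F.eINP, F.eOUT, F.eW, F.eS2, F.eD, F.cap, fT1, fT0, fSym, fLev, TabParams.fTim, K, N, KI, SI, AI, BI, KK, S, L, S2, D, Y, II, SEND, NP, INP, OUT, F.eN, addr_r, addr_x, addr_yp, addr_yv, addr_u, addr_h, addr_hc, addr_sw, addr_lt, addr_ae, addr_dummy]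
            all_goals simp only [addrF, List.getD_cons_zero, List.getD_cons_succ, List.getD_nil, ev_rvE, ev_dum, ev_enc, ev_add, ev_sub, ev_mul, ev_div, ev_mod, ev_c, ev_cst, ev_cond, ev_eq, ev_lt, SkelExpr.NE.eval_le, ev_pow2, ev_tab1, ev_and', ev_or', ev_not', ev_bit, eKI, eSI, eAI, eBI, F.eK, F.eKK, F.eS, F.eL, F.eY, F.eII, F.eSEND, F.eNP, F.eINP, F.eOUT, F.eW, F.eS2, F.eD, F.cap, fT1, fT0, fSym, fLev, TabParams.fTim, K, N, KI, SI, AI, BI, KK, S, L, S2, D, Y, II, SEND, NP, INP, OUT, F.eN, addr_r, addr_x, addr_yp, addr_yv, addr_u, addr_h, addr_hc, addr_sw, addr_lt, addr_ae, addr_dummy]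
        · refine Or.inr ⟨?_, ?_⟩
          · rw [hcore]; simp only [conCore]; unfold famTr; rw [if_pos h]; simp only [hPq, ho0, if_false]
          · simp only [ttF]
            rw [sel_zero (by rw [ev_eq, ev_c]; simp [hk2]), sel_zero (by rw [ev_eq, eBI', ev_c]; simp [ho0]), ev_c]
    · intro h; rw [hcore]; simp only [conCore]; unfold famTr; rw [if_neg h]

  · -- family 14: famAcc
    refine famOK_intro (R := True) ?_ ?_ ?_
    · simp only [rangeE, ev_c]; simp
    · intro h
      refine Or.inl ⟨_, [TabVar.u tb.Send tb.np], by rw [hcore]; simp only [conCore]; unfold famAcc; rfl, ?_, ?_⟩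
      · simp only [ttF, ev_c]; rfl
      · intro m hm
        interval_cases m <;> simp only [addrF, List.getD_cons_zero, List.getD_cons_succ, List.getD_nil, ev_rvE, ev_dum, ev_enc, ev_add, ev_sub, ev_mul, ev_div, ev_mod, ev_c, ev_cst, ev_cond, ev_eq, ev_lt, SkelExpr.NE.eval_le, ev_pow2, ev_tab1, ev_and', ev_or', ev_not', ev_bit, eKI, eSI, eAI, eBI, F.eK, F.eKK, F.eS, F.eL, F.eY, F.eII, F.eSEND, F.eNP, F.eINP, F.eOUT, F.eW, F.eS2, F.eD, F.cap, fT1, fT0, fSym, fLev, TabParams.fTim, K, N, KI, SI, AI, BI, KK, S, L, S2, D, Y, II, SEND, NP, INP, OUT, F.eN, addr_r, addr_x, addr_yp, addr_yv, addr_u, addr_h, addr_hc, addr_sw, addr_lt, addr_ae, addr_dummy]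
    · intro h; exact absurd trivial h
  · -- family 15: famNet
    refine famOK_intro (R := ai < tb.L ∧ si < tb.S ∧ bi < tb.W) ?_ ?_ ?_
    · simp only [rangeE, ev_rvE, ev_dum, ev_enc, ev_add, ev_sub, ev_mul, ev_div, ev_mod, ev_c, ev_cst, ev_cond, ev_eq, ev_lt, SkelExpr.NE.eval_le, ev_pow2, ev_tab1, ev_and', ev_or', ev_not', ev_bit, eKI, eSI, eAI, eBI, F.eK, F.eKK, F.eS, F.eL, F.eY, F.eII, F.eSEND, F.eNP, F.eINP, F.eOUT, F.eW, F.eS2, F.eD, F.cap, fT1, fT0, fSym, fLev, TabParams.fTim, K, N, KI, SI, AI, BI, KK, S, L, S2, D, Y, II, SEND, NP, INP, OUT, F.eN, ite01_mul, ite01_or, ite01_not]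
      rw [ite01_ne_zero]
    · intro h
      have hdim : eval dimE x = tb.dim ai := by
        simp only [dimE, ev_rvE, ev_dum, ev_enc, ev_add, ev_sub, ev_mul, ev_div, ev_mod, ev_c, ev_cst, ev_cond, ev_eq, ev_lt, SkelExpr.NE.eval_le, ev_pow2, ev_tab1, ev_and', ev_or', ev_not', ev_bit, eKI, eSI, eAI, eBI, F.eK, F.eKK, F.eS, F.eL, F.eY, F.eII, F.eSEND, F.eNP, F.eINP, F.eOUT, F.eW, F.eS2, F.eD, F.cap, fT1, fT0, fSym, fLev, TabParams.fTim, K, N, KI, SI, AI, BI, KK, S, L, S2, D, Y, II, SEND, NP, INP, OUT, F.eN]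
        rw [TabParams.dim, getD_dims _ _ (by have := h.1; simp only [TabParams.L] at this; omega)]
        by_cases hlt : ai < tb.k
        · rw [if_neg (by simp [hlt]), if_pos hlt]
        · rw [if_pos (by simp [hlt]), if_neg hlt]
      have hdk : tb.dim ai < tb.k := by
        unfold TabParams.dim
        have hl : ai < (dims tb.k).length := by rw [length_dims]; exact h.1
        rw [List.getD_eq_getElem _ _ hl]; exact dims_lt _ _ (List.getElem_mem hl)
      have hmin : min (eval dimE x) x.1 = tb.dim ai := by rw [hdim, F.cap]; omega
      have hbase : eval baseE x = base (tb.dim ai) si := by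
        simp only [baseE, ev_cond, ev_eq, ev_mod, ev_div, ev_pow2, ev_sub, ev_c, eSI', hmin, Benes.base]
        by_cases hb1 : si / 2 ^ tb.dim ai % 2 = 1
        · rw [if_pos hb1, if_neg (by decide), if_pos hb1]
        · rw [if_neg hb1, if_pos rfl, if_neg hb1]
      have hflip : eval flipE x = flipBit (tb.dim ai) si := by
        simp only [flipE, ev_cond, ev_eq, ev_mod, ev_div, ev_pow2, ev_sub, ev_add, ev_c, eSI', hmin, Benes.flipBit]
        by_cases hb1 : si / 2 ^ tb.dim ai % 2 = 1
        · rw [if_pos hb1, if_neg (by decide), if_pos hb1]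
        · rw [if_neg hb1, if_pos rfl, if_neg hb1]
      refine Or.inl ⟨_, [TabVar.r ⟨κi, hκ⟩ (ai + 1) si bi, TabVar.sw ⟨κi, hκ⟩ ai (base (tb.dim ai) si),
        TabVar.r ⟨κi, hκ⟩ ai (flipBit (tb.dim ai) si) bi, TabVar.r ⟨κi, hκ⟩ ai si bi], by rw [hcore]; simp only [conCore]; unfold famNet; rw [if_pos h]; rfl, ?_, ?_⟩
      · simp only [ttF, ev_c]; rfl
      · intro m hm
        interval_cases m <;> simp only [addrF, List.getD_cons_zero, List.getD_cons_succ, List.getD_nil, hbase, hflip, ev_rvE, ev_dum, ev_enc, ev_add, ev_sub, ev_mul, ev_div, ev_mod, ev_c, ev_cst, ev_cond, ev_eq, ev_lt, SkelExpr.NE.eval_le, ev_pow2, ev_tab1, ev_and', ev_or', ev_not', ev_bit, eKI, eSI, eAI, eBI, F.eK, F.eKK, F.eS, F.eL, F.eY, F.eII, F.eSEND, F.eNP, F.eINP, F.eOUT, F.eW, F.eS2, F.eD, F.cap, fT1, fT0, fSym, fLev, TabParams.fTim, K, N, KI, SI, AI, BI, KK, S, L, S2, D, Y, II, SEND, NP,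 INP, OUT, F.eN, addr_r, addr_x, addr_yp, addr_yv, addr_u, addr_h, addr_hc, addr_sw, addr_lt, addr_ae, addr_dummy]
    · intro h; rw [hcore]; simp only [conCore]; unfold famNet; rw [if_neg h]

  · -- family 16: famLt0
    refine famOK_intro (R := si + 1 < tb.S) ?_ ?_ ?_
    · simp only [rangeE, ev_rvE, ev_dum, ev_enc, ev_add, ev_sub, ev_mul, ev_div, ev_mod, ev_c, ev_cst, ev_cond, ev_eq, ev_lt, SkelExpr.NE.eval_le, ev_pow2, ev_tab1, ev_and', ev_or', ev_not', ev_bit, eKI, eSI, eAI, eBI, F.eK, F.eKK, F.eS, F.eL, F.eY, F.eII, F.eSEND, F.eNP, F.eINP, F.eOUT, F.eW, F.eS2, F.eD, F.cap, fT1, fT0, fSym, fLev, TabParams.fTim, K, N, KI, SI, AI, BI, KK, S, L, S2, D, Y, II, SEND, NP, INP, OUT, F.eN, ite01_mul, ite01_or, ite01_not]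
      rw [ite01_ne_zero]
    · intro h
      refine Or.inl ⟨_, [TabVar.lt ⟨κi, hκ⟩ si 0], by rw [hcore]; simp only [conCore]; unfold famLt0; rw [if_pos h]; rfl, ?_, ?_⟩
      · simp only [ttF, ev_c]; rfl
      · intro m hm
        interval_cases m <;> simp only [addrF, List.getD_cons_zero, List.getD_cons_succ, List.getD_nil, ev_rvE, ev_dum, ev_enc, ev_add, ev_sub, ev_mul, ev_div, ev_mod, ev_c, ev_cst, ev_cond, ev_eq, ev_lt, SkelExpr.NE.eval_le, ev_pow2, ev_tab1, ev_and', ev_or', ev_not', ev_bit, eKI, eSI, eAI, eBI, F.eK, F.eKK, F.eS, F.eL, F.eY, F.eII, F.eSEND, F.eNP, F.eINP, F.eOUT, F.eW, F.eS2, F.eD, F.cap, fT1, fT0, fSym, fLev, TabParams.fTim, K, N, KI, SI, AI, BI, KK, S, L, S2, D, Y, II, SEND, NP, INP, OUT, F.eN, addr_r, addr_x, addr_yp, addr_yv, addr_u, addr_h, addr_hc, addr_sw, addr_lt, addr_ae, addr_dummy]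
    · intro h; rw [hcore]; simp only [conCore]; unfold famLt0; rw [if_neg h]
  · -- family 17: famLtStep
    refine famOK_intro (R := si + 1 < tb.S ∧ ai < 2 * tb.k + 1) ?_ ?_ ?_
    · simp only [rangeE, ev_rvE, ev_dum, ev_enc, ev_add, ev_sub, ev_mul, ev_div, ev_mod, ev_c, ev_cst, ev_cond, ev_eq, ev_lt, SkelExpr.NE.eval_le, ev_pow2, ev_tab1, ev_and', ev_or', ev_not', ev_bit, eKI, eSI, eAI, eBI, F.eK, F.eKK, F.eS, F.eL, F.eY, F.eII, F.eSEND, F.eNP, F.eINP, F.eOUT, F.eW, F.eS2, F.eD, F.cap, fT1, fT0, fSym, fLev, TabParams.fTim, K, N, KI, SI, AI, BI, KK, S, L, S2, D, Y, II, SEND, NP, INP, OUT, F.eN, ite01_mul, ite01_or, ite01_not]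
      rw [ite01_ne_zero]
    · intro h
      refine Or.inl ⟨_, [TabVar.lt ⟨κi, hκ⟩ si (ai + 1), TabVar.r ⟨κi, hκ⟩ tb.L si (tb.fKey ai), TabVar.r ⟨κi, hκ⟩ tb.L (si + 1) (tb.fKey ai), TabVar.lt ⟨κi, hκ⟩ si ai], by rw [hcore]; simp only [conCore]; unfold famLtStep; rw [if_pos h]; rfl, ?_, ?_⟩
      · simp only [ttF, ev_c]; rfl
      · intro m hm
        have hfk : eval fKeyE x = tb.fKey ai := by
          simp only [fKeyE, ev_rvE, ev_dum, ev_enc, ev_add, ev_sub, ev_mul, ev_div, ev_mod, ev_c, ev_cst, ev_cond, ev_eq, ev_lt, SkelExpr.NE.eval_le, ev_pow2, ev_tab1, ev_and', ev_or', ev_not', ev_bit, eKI, eSI, eAI, eBI, F.eK, F.eKK, F.eS, F.eL, F.eY, F.eII, F.eSEND, F.eNP, F.eINP, F.eOUT, F.eW, F.eS2, F.eD, F.cap, fT1, fT0, fSym, fLev, TabParams.fTim, K, N, KI, SI, AI, BI, KK, S, L, S2, D, Y, II, SEND, NP, INP, OUT, F.eN, TabParams.fKey]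
          by_cases hh : ai < tb.k <;> simp [hh]
        interval_cases m <;> simp only [addrF, List.getD_cons_zero, List.getD_cons_succ, List.getD_nil, hfk, ev_rvE, ev_dum, ev_enc, ev_add, ev_sub, ev_mul, ev_div, ev_mod, ev_c, ev_cst, ev_cond, ev_eq, ev_lt, SkelExpr.NE.eval_le, ev_pow2, ev_tab1, ev_and', ev_or', ev_not', ev_bit, eKI, eSI, eAI, eBI, F.eK, F.eKK, F.eS, F.eL, F.eY, F.eII, F.eSEND, F.eNP, F.eINP, F.eOUT, F.eW, F.eS2, F.eD, F.cap, fT1, fT0, fSym, fLev, TabParams.fTim, K, N, KI, SI, AI, BI, KK, S, L, S2, D, Y, II, SEND, NP, INP, OUT, F.eN, TabParams.fKey, addr_r, addr_x, addr_yp, addr_yv, addr_u, addr_h, addr_hc, addr_sw, addr_lt, addr_ae, addr_dummy]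
    · intro h; rw [hcore]; simp only [conCore]; unfold famLtStep; rw [if_neg h]
  · -- family 18: famLtF
    refine famOK_intro (R := si + 1 < tb.S) ?_ ?_ ?_
    · simp only [rangeE, ev_rvE, ev_dum, ev_enc, ev_add, ev_sub, ev_mul, ev_div, ev_mod, ev_c, ev_cst, ev_cond, ev_eq, ev_lt, SkelExpr.NE.eval_le, ev_pow2, ev_tab1, ev_and', ev_or', ev_not', ev_bit, eKI, eSI, eAI, eBI, F.eK, F.eKK, F.eS, F.eL, F.eY, F.eII, F.eSEND, F.eNP, F.eINP, F.eOUT, F.eW, F.eS2, F.eD, F.cap, fT1, fT0, fSym, fLev, TabParams.fTim, K, N, KI, SI, AI, BI, KK, S, L, S2, D, Y, II, SEND, NP, INP, OUT, F.eN, ite01_mul, ite01_or, ite01_not]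
      rw [ite01_ne_zero]
    · intro h
      refine Or.inl ⟨_, [TabVar.lt ⟨κi, hκ⟩ si (2 * tb.k + 1)], by rw [hcore]; simp only [conCore]; unfold famLtF; rw [if_pos h]; rfl, ?_, ?_⟩
      · simp only [ttF, ev_c]; rfl
      · intro m hm
        interval_cases m <;> simp only [addrF, List.getD_cons_zero, List.getD_cons_succ, List.getD_nil, ev_rvE, ev_dum, ev_enc, ev_add, ev_sub, ev_mul, ev_div, ev_mod, ev_c, ev_cst, ev_cond, ev_eq, ev_lt, SkelExpr.NE.eval_le, ev_pow2, ev_tab1, ev_and', ev_or', ev_not', ev_bit, eKI, eSI, eAI, eBI, F.eK, F.eKK, F.eS, F.eL, F.eY, F.eII, F.eSEND, F.eNP, F.eINP, F.eOUT, F.eW, F.eS2, F.eD, F.cap, fT1, fT0, fSym, fLev, TabParams.fTim, K, N, KI, SI, AI, BI, KK, S, L, S2, D, Y, II, SEND, NP, INP, OUT, F.eN, addr_r, addr_x, addr_yp, addr_yv, addr_u, addr_h, addr_hc, addr_sw, addr_lt, addr_ae, addr_dummy]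
    · intro h; rw [hcore]; simp only [conCore]; unfold famLtF; rw [if_neg h]
  · -- family 19: famAe0
    refine famOK_intro (R := si + 1 < tb.S) ?_ ?_ ?_
    · simp only [rangeE, ev_rvE, ev_dum, ev_enc, ev_add, ev_sub, ev_mul, ev_div, ev_mod, ev_c, ev_cst, ev_cond, ev_eq, ev_lt, SkelExpr.NE.eval_le, ev_pow2, ev_tab1, ev_and', ev_or', ev_not', ev_bit, eKI, eSI, eAI, eBI, F.eK, F.eKK, F.eS, F.eL, F.eY, F.eII, F.eSEND, F.eNP, F.eINP, F.eOUT, F.eW, F.eS2, F.eD, F.cap, fT1, fT0, fSym, fLev, TabParams.fTim, K, N, KI, SI, AI, BI, KK, S, L, S2, D, Y, II, SEND, NP, INP, OUT, F.eN, ite01_mul, ite01_or, ite01_not]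
      rw [ite01_ne_zero]
    · intro h
      refine Or.inl ⟨_, [TabVar.ae ⟨κi, hκ⟩ si 0], by rw [hcore]; simp only [conCore]; unfold famAe0; rw [if_pos h]; rfl, ?_, ?_⟩
      · simp only [ttF, ev_c]; rfl
      · intro m hm
        interval_cases m <;> simp only [addrF, List.getD_cons_zero, List.getD_cons_succ, List.getD_nil, ev_rvE, ev_dum, ev_enc, ev_add, ev_sub, ev_mul, ev_div, ev_mod, ev_c, ev_cst, ev_cond, ev_eq, ev_lt, SkelExpr.NE.eval_le, ev_pow2, ev_tab1, ev_and', ev_or', ev_not', ev_bit, eKI, eSI, eAI, eBI, F.eK, F.eKK, F.eS, F.eL, F.eY, F.eII, F.eSEND, F.eNP, F.eINP, F.eOUT, F.eW, F.eS2, F.eD, F.cap, fT1, fT0, fSym, fLev, TabParams.fTim, K, N, KI, SI, AI, BI, KK, S, L, S2, D, Y, II, SEND, NP, INP, OUT, F.eN, addr_r, addr_x, addr_yp, addr_yv, addr_u, addr_h, addr_hc, addr_sw, addr_lt, addr_ae, addr_dummy]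
    · intro h; rw [hcore]; simp only [conCore]; unfold famAe0; rw [if_neg h]
  · -- family 20: famAeStep
    refine famOK_intro (R := si + 1 < tb.S ∧ ai ≤ tb.k) ?_ ?_ ?_
    · simp only [rangeE, ev_rvE, ev_dum, ev_enc, ev_add, ev_sub, ev_mul, ev_div, ev_mod, ev_c, ev_cst, ev_cond, ev_eq, ev_lt, SkelExpr.NE.eval_le, ev_pow2, ev_tab1, ev_and', ev_or', ev_not', ev_bit, eKI, eSI, eAI, eBI, F.eK, F.eKK, F.eS, F.eL, F.eY, F.eII, F.eSEND, F.eNP, F.eINP, F.eOUT, F.eW, F.eS2, F.eD, F.cap, fT1, fT0, fSym, fLev, TabParams.fTim, K, N, KI, SI, AI, BI, KK, S, L, S2, D, Y, II, SEND, NP, INP, OUT, F.eN, ite01_mul, ite01_or, ite01_not]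
      rw [ite01_ne_zero]
    · intro h
      refine Or.inl ⟨_, [TabVar.ae ⟨κi, hκ⟩ si (ai + 1), TabVar.ae ⟨κi, hκ⟩ si ai, TabVar.r ⟨κi, hκ⟩ tb.L si (fLev ai), TabVar.r ⟨κi, hκ⟩ tb.L (si + 1) (fLev ai)], by rw [hcore]; simp only [conCore]; unfold famAeStep; rw [if_pos h]; rfl, ?_, ?_⟩
      · simp only [ttF, ev_c]; rfl
      · intro m hm
        interval_cases m <;> simp only [addrF, List.getD_cons_zero, List.getD_cons_succ, List.getD_nil, ev_rvE, ev_dum, ev_enc, ev_add, ev_sub, ev_mul, ev_div, ev_mod, ev_c, ev_cst, ev_cond, ev_eq, ev_lt, SkelExpr.NE.eval_le, ev_pow2, ev_tab1, ev_and', ev_or', ev_not', ev_bit, eKI, eSI, eAI, eBI, F.eK, F.eKK, F.eS, F.eL, F.eY, F.eII, F.eSEND, F.eNP, F.eINP, F.eOUT, F.eW, F.eS2, F.eD, F.cap, fT1, fT0, fSym, fLev, TabParams.fTim, K, N, KI, SI, AI, BI, KK, S, L, S2, D, Y, II, SEND, NP, INP, OUT, F.eN, addr_r, addr_x, addr_yp,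 addr_yv, addr_u, addr_h, addr_hc, addr_sw, addr_lt, addr_ae, addr_dummy]
    · intro h; rw [hcore]; simp only [conCore]; unfold famAeStep; rw [if_neg h]
  · -- family 21: famAdj1
    refine famOK_intro (R := si + 1 < tb.S) ?_ ?_ ?_
    · simp only [rangeE, ev_rvE, ev_dum, ev_enc, ev_add, ev_sub, ev_mul, ev_div, ev_mod, ev_c, ev_cst, ev_cond, ev_eq, ev_lt, SkelExpr.NE.eval_le, ev_pow2, ev_tab1, ev_and', ev_or', ev_not', ev_bit, eKI, eSI, eAI, eBI, F.eK, F.eKK, F.eS, F.eL, F.eY, F.eII, F.eSEND, F.eNP, F.eINP, F.eOUT, F.eW, F.eS2, F.eD, F.cap, fT1, fT0, fSym, fLev, TabParams.fTim, K, N, KI, SI, AI, BI, KK, S, L, S2, D, Y, II, SEND, NP, INP, OUT, F.eN, ite01_mul, ite01_or, ite01_not]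
      rw [ite01_ne_zero]
    · intro h
      refine Or.inl ⟨_, [TabVar.r ⟨κi, hκ⟩ tb.L (si + 1) fT1, TabVar.r ⟨κi, hκ⟩ tb.L (si + 1) fT0, TabVar.r ⟨κi, hκ⟩ tb.L si fT1, TabVar.r ⟨κi, hκ⟩ tb.L si fT0, TabVar.ae ⟨κi, hκ⟩ si (tb.k + 1)], by rw [hcore]; simp only [conCore]; unfold famAdj1; rw [if_pos h]; rfl, ?_, ?_⟩
      · simp only [ttF, ev_c]; rfl
      · intro m hm
        interval_cases m <;> simp only [addrF, List.getD_cons_zero, List.getD_cons_succ, List.getD_nil, ev_rvE, ev_dum, ev_enc, ev_add, ev_sub, ev_mul, ev_div, ev_mod, ev_c, ev_cst, ev_cond, ev_eq, ev_lt, SkelExpr.NE.eval_le, ev_pow2, ev_tab1, ev_and', ev_or', ev_not', ev_bit, eKI, eSI, eAI, eBI, F.eK, F.eKK, F.eS, F.eL, F.eY, F.eII, F.eSEND, F.eNP, F.eINP, F.eOUT, F.eW, F.eS2, F.eD, F.cap, fT1, fT0, fSym, fLev, TabParams.fTim, K, N, KI, SI, AI, BI, KK, S, L, S2, D, Y, II,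 SEND, NP, INP, OUT, F.eN, addr_r, addr_x, addr_yp, addr_yv, addr_u, addr_h, addr_hc, addr_sw, addr_lt, addr_ae, addr_dummy]
    · intro h; rw [hcore]; simp only [conCore]; unfold famAdj1; rw [if_neg h]
  · -- family 22: famAdj2
    refine famOK_intro (R := si + 1 < tb.S) ?_ ?_ ?_
    · simp only [rangeE, ev_rvE, ev_dum, ev_enc, ev_add, ev_sub, ev_mul, ev_div, ev_mod, ev_c, ev_cst, ev_cond, ev_eq, ev_lt, SkelExpr.NE.eval_le, ev_pow2, ev_tab1, ev_and', ev_or', ev_not', ev_bit, eKI, eSI, eAI, eBI, F.eK, F.eKK, F.eS, F.eL, F.eY, F.eII, F.eSEND, F.eNP, F.eINP, F.eOUT, F.eW, F.eS2, F.eD, F.cap, fT1, fT0, fSym, fLev, TabParams.fTim, K, N, KI, SI, AI, BI, KK, S, L, S2, D, Y, II, SEND, NP, INP, OUT, F.eN, ite01_mul, ite01_or, ite01_not]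
      rw [ite01_ne_zero]
    · intro h
      refine Or.inl ⟨_, [TabVar.r ⟨κi, hκ⟩ tb.L (si + 1) fT1, TabVar.r ⟨κi, hκ⟩ tb.L (si + 1) fT0, TabVar.r ⟨κi, hκ⟩ tb.L si fSym, TabVar.r ⟨κi, hκ⟩ tb.L (si + 1) fSym], by rw [hcore]; simp only [conCore]; unfold famAdj2; rw [if_pos h]; rfl, ?_, ?_⟩
      · simp only [ttF, ev_c]; rfl
      · intro m hm
        interval_cases m <;> simp only [addrF, List.getD_cons_zero, List.getD_cons_succ, List.getD_nil, ev_rvE, ev_dum, ev_enc, ev_add, ev_sub, ev_mul, ev_div, ev_mod, ev_c, ev_cst, ev_cond, ev_eq, ev_lt, SkelExpr.NE.eval_le, ev_pow2, ev_tab1, ev_and', ev_or', ev_not', ev_bit, eKI, eSI, eAI, eBI, F.eK, F.eKK, F.eS, F.eL, F.eY, F.eII, F.eSEND, F.eNP, F.eINP, F.eOUT, F.eW, F.eS2, F.eD, F.cap, fT1, fT0, fSym, fLev, TabParams.fTim, K, N, KI, SI, AI, BI, KK, S, L, S2, D, Y, II, SEND, NP, INP, OUT, F.eN, addr_r, addr_x,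 addr_yp, addr_yv, addr_u, addr_h, addr_hc, addr_sw, addr_lt, addr_ae, addr_dummy]
    · intro h; rw [hcore]; simp only [conCore]; unfold famAdj2; rw [if_neg h]
  · -- family 23: famFirst
    refine famOK_intro (R := True) ?_ ?_ ?_
    · simp only [rangeE, ev_c]; simp
    · intro h
      refine Or.inl ⟨_, [TabVar.r ⟨κi, hκ⟩ tb.L 0 fT1, TabVar.r ⟨κi, hκ⟩ tb.L 0 fT0], by rw [hcore]; simp only [conCore]; unfold famFirst; rfl, ?_, ?_⟩
      · simp only [ttF, ev_c]; rfl
      · intro m hm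
        interval_cases m <;> simp only [addrF, List.getD_cons_zero, List.getD_cons_succ, List.getD_nil, ev_rvE, ev_dum, ev_enc, ev_add, ev_sub, ev_mul, ev_div, ev_mod, ev_c, ev_cst, ev_cond, ev_eq, ev_lt, SkelExpr.NE.eval_le, ev_pow2, ev_tab1, ev_and', ev_or', ev_not', ev_bit, eKI, eSI, eAI, eBI, F.eK, F.eKK, F.eS, F.eL, F.eY, F.eII, F.eSEND, F.eNP, F.eINP, F.eOUT, F.eW, F.eS2, F.eD, F.cap, fT1, fT0, fSym, fLev, TabParams.fTim, K, N, KI, SI, AI, BI, KK, S, L, S2, D, Y, II, SEND, NP, INP, OUT, F.eN, addr_r, addr_x, addr_yp, addr_yv, addr_u, addr_h, addr_hc, addr_sw, addr_lt, addr_ae, addr_dummy]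
    · intro h; exact absurd trivial h
  · -- family 24: trivial
    refine famOK_intro (R := False) ?_ ?_ ?_
    · simp [rangeE, ev_c]
    · intro h; exact h.elim
    · intro _; rw [hcore]; rfl
  · -- family 25: trivial
    refine famOK_intro (R := False) ?_ ?_ ?_
    · simp [rangeE, ev_c]
    · intro h; exact h.elim
    · intro _; rw [hcore]; rfl
  · -- family 26: trivial
    refine famOK_intro (R := False) ?_ ?_ ?_
    · simp [rangeE, ev_c]
    · intro h; exact h.elim
    · intro _; rw [hcore]; rfl
  · -- family 27: trivial
    refine famOK_intro (R := False) ?_ ?_ ?_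
    · simp [rangeE, ev_c]
    · intro h; exact h.elim
    · intro _; rw [hcore]; rfl
  · -- family 28: trivial
    refine famOK_intro (R := False) ?_ ?_ ?_
    · simp [rangeE, ev_c]
    · intro h; exact h.elim
    · intro _; rw [hcore]; rfl
  · -- family 29: trivial
    refine famOK_intro (R := False) ?_ ?_ ?_
    · simp [rangeE, ev_c]
    · intro h; exact h.elim
    · intro _; rw [hcore]; rfl
  · -- family 30: trivial
    refine famOK_intro (R := False) ?_ ?_ ?_
    · simp [rangeE, ev_c]
    · intro h; exact h.elim
    · intro _; rw [hcore]; rfl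
  · -- family 31: trivial
    refine famOK_intro (R := False) ?_ ?_ ?_
    · simp [rangeE, ev_c]
    · intro h; exact h.elim
    · intro _; rw [hcore]; rfl
end AllFamilies

/-! ### Generic mode: the clause -/

section GenericClause

variable {d Lg}

/-- Polarity of the literals of the blocking clauses. [folklore] -/
theorem pol_eq {x : SkelExpr.Env} (m : ℕ) (hm : m ≤ x.1) :
    (!decide (eval (polE m) x = 0)) = !ThreeCNF.bit m (eval (var pRHO) x) := by
  rw [polE, ev_not', ev_bit, ev_c, min_eq_left hm, ThreeCNF.bit]
  rcases Nat.mod_two_eq_zero_or_one (eval (var pRHO) x / 2 ^ m) with h | h <;> simp [h]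

/-- The index tuple of a constraint id below `NC` is in the box. [folklore] -/
theorem tupOf_box (tb : TabParams) {id : ℕ} (hid : id < tb.NC) :
    (tupOf tb id).1 < 32 ∧ (tupOf tb id).2.1 < tb.K ∧ (tupOf tb id).2.2.1 < tb.S2 ∧ (tupOf tb id).2.2.2.1 < tb.D ∧
      (tupOf tb id).2.2.2.2 < tb.D := by
  have hK : 0 < tb.K := Fin.pos tb.inp
  have hS2 : 0 < tb.S2 := by show 0 < 2 * 2 ^ tb.k; positivity
  have hD : 0 < tb.D := by show 0 < tb.W + tb.np + 2; omega
  refine ⟨Nat.mod_lt _ (by norm_num), Nat.mod_lt _ hK, Nat.mod_lt _ hS2, Nat.mod_lt _ hD, ?_⟩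
  show id / 32 / tb.K / tb.S2 / tb.D < tb.D
  rw [Nat.div_lt_iff_lt_mul hD, Nat.div_lt_iff_lt_mul hS2, Nat.div_lt_iff_lt_mul hK, Nat.div_lt_iff_lt_mul (by norm_num)]
  have : tb.NC = tb.D * tb.D * tb.S2 * tb.K * 32 := by
    show 32 * (tb.K * (tb.S2 * (tb.D * tb.D))) = _; ring
  omega

/-- **In generic mode the generator outputs the tableau skeleton `skTab`.** [folklore] -/
theorem genOut_eq (n i : ℕ) (b : Bool) : genOut (envOf d Lg n i b) = skTab (d.tb n) i b := by
  classical
  set x := envOf d Lg n i b with hx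
  have F : EnvFacts d x (d.tb n) n i b := envFacts n i b
  set tb := d.tb n with htb
  have hn : tb.n = n := rfl
  have hcap : x.1 = tb.k + 70 := F.cap
  unfold genOut skTab
  rw [hn]
  have tI : (eval (lt (var pI) N) x = 0) ↔ ¬ i < n := by
    rw [ev_lt, F.eI, show eval N x = n from F.eN]; exact ite01_eq_zero _
  have tN : (eval (lt (var pI) (var pNCL)) x = 0) ↔ ¬ i < tb.NCl := by
    rw [ev_lt, F.eI, F.eNCL]; exact ite01_eq_zero _
  simp only [tI, tN]
  by_cases h1 : i < n
  · rw [if_neg (not_not.2 h1), if_pos h1, litOf_eq, ev_mul, ev_mul, ev_c, F.eI, F.eB, show eval K x = tb.K from F.eK,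
      addr_x]
    have e1 : 16 * tb.K * i = 0 + 16 * (0 + tb.K * (i + tb.S2 * (0 + tb.D * 0))) := by ring
    rw [e1]; cases b <;> simp
  rw [if_pos h1, if_neg h1]
  by_cases h2 : i < tb.NCl
  swap
  · rw [if_pos h2, if_neg h2]
  rw [if_neg (not_not.2 h2), if_pos h2]
  -- the compiled clause of constraint `id`
  set id := (i - n) / 256 with hid
  set j := (i - n) % 256 with hj
  have hj256 : j < 256 := Nat.mod_lt _ (by norm_num)
  set ρ := j / 4 with hρ
  set t := j % 4 with ht
  have hρ64 : ρ < 64 := by rw [hρ]; omega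
  have ht4 : t < 4 := Nat.mod_lt _ (by norm_num)
  have hidNC : id < tb.NC := by
    have : tb.NCl = tb.n + 256 * tb.NC := rfl
    rw [hid, Nat.div_lt_iff_lt_mul (by norm_num)]; omega
  obtain ⟨hf, hκ, hs, ha, hb⟩ := tupOf_box tb hidNC
  obtain ⟨hTT, hAD⟩ := famOK_of_facts F hκ hs ha hb F.eKI F.eSI F.eAI F.eBI _ hf
  set cc := conOf tb (tupOf tb id).1 (tupOf tb id).2.1 (tupOf tb id).2.2.1 (tupOf tb id).2.2.2.1 (tupOf tb id).2.2.2.2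
    with hcc
  have hconN : conN tb id = toCon tb cc := rfl
  -- dispatch
  have hev : eval ttExpr x = eval (cond (rangeE (tupOf tb id).1) (ttF (tupOf tb id).1) (c ttTrue)) x := by
    rw [ttExpr, eval_dispatch, F.eFAM]
    by_cases hlt : (tupOf tb id).1 < 24
    · rw [if_pos hlt]
    · rw [if_neg hlt]
      generalize hg : (tupOf tb id).1 = g at hlt hf ⊢
      interval_cases g <;> rfl
  have hadisp : ∀ m, eval (addrExpr m) x = eval ((addrF (tupOf tb id).1).getD m dum) x := by
    intro m
    rw [addrExpr, eval_dispatch, F.eFAM]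
    by_cases hlt : (tupOf tb id).1 < 24
    · rw [if_pos hlt]
    · rw [if_neg hlt]
      generalize hg : (tupOf tb id).1 = g at hlt hf ⊢
      interval_cases g <;> rfl
  -- the predicate on row ρ
  set P := cc.pred (ThreeCNF.bit 0 ρ) (ThreeCNF.bit 1 ρ) (ThreeCNF.bit 2 ρ) (ThreeCNF.bit 3 ρ) (ThreeCNF.bit 4 ρ)
    (ThreeCNF.bit 5 ρ) with hP
  have hpredrow : (conN tb id).pred (ThreeCNF.row ρ) = P := rfl
  have ebit : eval (SkelExpr.NE.bit (var pRHO) ttExpr) x = (if P then 1 else 0) := by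
    rw [ev_bit, F.eRHO, hcap, min_eq_left (by omega), hev, ← hρ]
    have hb' := hTT ρ hρ64
    rw [ThreeCNF.bit] at hb'
    change decide (_ = 1) = P at hb'
    by_cases hPt : P = true
    · rw [hPt] at hb' ⊢; rw [if_pos rfl]; exact of_decide_eq_true hb'
    · have hPf : P = false := by simpa using hPt
      rw [hPf] at hb' ⊢
      rw [if_neg (by simp)]
      have := of_decide_eq_false hb'
      omega
  unfold genClause ThreeCNF.Con.clause
  rw [if_pos hj256, ebit, ← hρ, hpredrow, ← ht]
  by_cases hPt : P = true
  · rw [hPt, if_neg (by simp), if_pos rfl]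
  have hPf : P = false := by simpa using hPt
  rw [hPf, if_pos (by simp)]
  simp only [Bool.false_eq_true, if_false]
  -- the chain clause
  have hlit : ∀ m : Fin 6, litOf (addrExpr m.val) (polE m.val) x = (conN tb id).lit ρ m := by
    intro m
    rw [litOf_eq, ThreeCNF.Con.lit, hadisp, hAD ρ hρ64 hPf m, pol_eq _ (by rw [hcap]; have := m.2; omega), F.eRHO]
    rfl
  have eT4 : eval (var pT4) x = t := F.eT4
  have eA0 : litOf (var pAUX) (c 1) x = (auxBase tb id + 4 * ρ, true) := by
    simp only [litOf_eq, F.eAUX, ev_c]; rfl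
  have eA0' : litOf (var pAUX) (c 0) x = (auxBase tb id + 4 * ρ, false) := by
    simp only [litOf_eq, F.eAUX, ev_c]; rfl
  have eA1 : litOf (add (var pAUX) (c 1)) (c 1) x = (auxBase tb id + 4 * ρ + 1, true) := by
    simp only [litOf_eq, ev_add, F.eAUX, ev_c]; rfl
  have eA1' : litOf (add (var pAUX) (c 1)) (c 0) x = (auxBase tb id + 4 * ρ + 1, false) := by
    simp only [litOf_eq, ev_add, F.eAUX, ev_c]; rfl
  have eA2 : litOf (add (var pAUX) (c 2)) (c 1) x = (auxBase tb id + 4 * ρ + 2, true) := by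
    simp only [litOf_eq, ev_add, F.eAUX, ev_c]; rfl
  have eA2' : litOf (add (var pAUX) (c 2)) (c 0) x = (auxBase tb id + 4 * ρ + 2, false) := by
    simp only [litOf_eq, ev_add, F.eAUX, ev_c]; rfl
  unfold ThreeCNF.Con.chain
  simp only [eT4]
  have l0 := hlit 0; have l1 := hlit 1; have l2 := hlit 2; have l3 := hlit 3; have l4 := hlit 4; have l5 := hlit 5
  simp only [Fin.val_zero, Fin.val_one] at l0 l1
  change litOf (addrExpr 2) (polE 2) x = _ at l2
  change litOf (addrExpr 3) (polE 3) x = _ at l3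
  change litOf (addrExpr 4) (polE 4) x = _ at l4
  change litOf (addrExpr 5) (polE 5) x = _ at l5
  by_cases h0 : t = 0
  · rw [if_pos h0, if_pos h0, l0, l1, eA0]
  rw [if_neg h0, if_neg h0]
  by_cases h1' : t = 1
  · rw [if_pos h1', if_pos h1', eA0', l2, eA1]
  rw [if_neg h1', if_neg h1']
  by_cases h2' : t = 2
  · rw [if_pos h2', if_pos h2', eA1', l3, eA2]
  rw [if_neg h2', if_neg h2', if_pos (show t = 3 by omega), eA2', l4, l5]

/-- **The universal generator computes the skeleton.** [folklore] -/
theorem ugen_descOf (n i : ℕ) (b : Bool) : ugen (descOf d Lg, (n, i, b)) = skAll Lg d n i b := by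
  rw [ugen, allExprs, env_eq, outG, skAll]
  have tM : (eval (lt N (var pN0)) (envOf d Lg n i b) = 0) ↔ ¬ n < d.N₀ := by
    rw [ev_lt, show eval N (envOf d Lg n i b) = n from (envFacts n i b).eN,
      show eval (var pN0) (envOf d Lg n i b) = d.N₀ by simp [envOf, nums, pN0, eval]]
    exact ite01_eq_zero _
  simp only [tM]
  by_cases h : n < d.N₀
  · rw [if_neg (not_not.2 h), if_pos h, tabOut_eq h]
  · rw [if_pos h, if_neg h, genOut_eq]

end GenericClause

end SkelGen

end Tableau

end Literature.Computability.Complexity
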